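import Literature.Analysis.FluidPDE.ConstantinDirectionDissipation
import Literature.Analysis.FluidPDE.ConstantinDirectionDissipationCalculus
import Literature.Analysis.FluidPDE.VorticityEquation
import Literature.Analysis.FluidPDE.MildSolutionProofs
import Literature.Analysis.FunctionSpaces.SobolevDomainProofs
import Mathlib.Analysis.SpecialFunctions.JapaneseBracket
import Mathlib.MeasureTheory.Integral.Prod
import Mathlib.MeasureTheory.Integral.IntervalIntegral.FundThmCalculus
import HarnessLib

/-!
# Constantin's direction-dissipation bound: the proof

Analysis/FluidPDE support file 2/2 for — and containing — the discharge
`Literature.Analysis.FluidPDE.constantin1990_direction_dissipation_bound_holds` of the named fact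
`Literature.Analysis.FluidPDE.constantin1990_direction_dissipation_bound`
(`ConstantinDirectionDissipation.lean`): for a classical solution `u` of the unforced
Navier–Stokes equations on `ℝ³ × [0, T)` which is Leray–Hopf from its rapidly decaying datum,
`ν ∫₀ᵀ∫ |ω| |∇ξ|²_F ≤ ‖ω₀‖_{L¹} + (2ν)⁻¹‖u₀‖²_{L²}`, `ω = curl u`, `ξ = ω/|ω|`.

The proof follows P. Constantin, *Navier–Stokes equations and area of interfaces*, Comm. Math.
Phys. 129 (1990), §2: multiply the vorticity equation (2.5) by `∇q(τω)` for the convex function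
`q(y) = √(1 + |y|²)` of (2.13)/(2.16) (here: by `ω/N`, `N = √(|ω|² + ε²)`, `ε = 1/τ`), which gives
(2.9): `(∂ₜ + u·∇ − νΔ) N + ν Dreg_ε = ⟪ω, (ω·∇)u⟫/N`, the positive Hessian term `Dreg_ε` being the
regularised direction dissipation; bound the right side by `|∇u| |ω|` — in fact by `|∇u|²_F`
(file 1, `abs_inner_curl_convect_le`) — and integrate, using the energy inequality (2.21).
Constantin integrates over the period box; on `ℝ³` we integrate against the smooth cut-off
`cutoff R` (`WholeSpaceIBP`) and control the three cut-off remainders by the Leray–Hopf `L²`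
quantities only (`u ∈ L^∞L²`, `∇u ∈ L²L²`), so that no decay of `ω(t)` for `t > 0` is needed:

* `integral_Ioo_integral_mul_inner_timeDerivWithin_div_regN` — time integration of
  `∫ φ ⟪ω, ∂ₜω⟫/N = d/dt ∫ φ (N − ε)` on a closed slab (Fubini + FTC on time lines);
* `IsClassicalNSSolutionOn.integral_mul_inner_timeDerivWithin_vorticity_div_regN` — the slice
  identity (vorticity equation from `VorticityEquation`, viscous and transport identities from
  file 1);
* `IsClassicalNSSolutionOn.direction_dissipation_slab_le` — the slab inequality
  `ν ∫₀^{T'}∫ φ Dlow_ε ≤ ∫ φ|ω₀| + |∫₀^{T'}∫ rest|` (`0 ≤ Dlow_ε ≤ Dreg_ε`, end term dropped);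
* `abs_rest_le`, `IsClassicalNSSolutionOn.abs_integral_rest_le` — the remainder
  `ν(Δφ)(N − ε) + (N − ε)(u·∇)φ + φ⟪ω, (ω·∇)u⟫/N` is bounded pointwise by
  `(νC₂λ/R² + C₁/R + 1)|∇u|²_F + νC₂/(2λR²) 1_{B̄(0,2R)} + (C₁/(2R))|u|²` (Young, `|ω|² ≤ 2|∇u|²_F`,
  `|Dφ| ≤ C₁/R`, `|Δφ| ≤ C₂/R²`), hence in `L¹((0,T') × ℝ³)` by
  `(…)∫∫|∇u|² + νC₂/(2λR²) T' |B̄(0,2R)| + (C₁/(2R)) ∫∫|u|²`, which is `O(R^{-1/2})` for `λ = R^{3/2}`;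
* `IsLerayHopfOn.lintegral_frobeniusNormSq_fderiv_of_classical` — the Leray–Hopf weak gradient is
  `∇u` a.e. (`HasWeakFDerivOn.unique_holds`), so `ν∫₀ᵀ∫|∇u|²_F ≤ ½‖u₀‖²₂` ((2.21));
* `constantin1990_direction_dissipation_bound_holds` — exhaust `(0,T) × ℝ³` by
  `(0, T − T/(m+2)) × B(0, m+1)` (where `cutoff (k²) = 1`, `k ≥ m+1`), let `k → ∞`, then
  `ε = 1/(n+1) → 0` by monotone convergence (`Dlow_{1/(n+1)} ↑ Dlow₀ = |ω||∇ξ|²_F`, file 1), and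
  use `‖ω₀‖₁ < ∞` (rapid decay of `u₀`, `integrable_norm_curl_of_hasRapidSpatialDecay`).

## Design notes

* As in file 1 there are no definitions and no notation: `N`, `Dreg_ε`, `Dlow_ε` are written out.
* All error terms are estimated as lower Lebesgue integrals (`norm_integral_integral_le_of_lintegral_le`),
  so that no integrability of `|ω(t)|²` on single slices is ever needed (it holds only for a.e. `t`).

## References

* P. Constantin, *Navier–Stokes equations and area of interfaces*, Comm. Math. Phys. 129 (1990)
  241–266, §2: (2.5)–(2.9), (2.13), (2.16), (2.21), Thm. 2.1. [Constantin1990]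
* P. Constantin, *Near identity transformations for the Navier–Stokes equations*, Handbook of
  Mathematical Fluid Dynamics II (2003), §3, Thm. 2 and the display after it.
-/

noncomputable section

open MeasureTheory Set Function Filter Metric
open scoped RealInnerProductSpace ENNReal NNReal Laplacian Topology

namespace Literature.Analysis.FluidPDE

/-! ### Time integration of `∫ φ ∂ₜ(N ∘ ω)` on a closed time slab -/

section Time

variable {T' : ℝ} {w : ℝ → (EuclideanSpace ℝ (Fin 3)) → (EuclideanSpace ℝ (Fin 3))}

/-- Joint continuity of the regularised modulus `(τ, x) ↦ √(|w τ x|² + ε²)` of a jointly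
continuous field. [folklore] -/
theorem continuousOn_regN_uncurry {S : Set ℝ} (hw : ContinuousOn (uncurry w) (S ×ˢ univ)) (ε : ℝ) :
    ContinuousOn (fun z : ℝ × (EuclideanSpace ℝ (Fin 3)) => Real.sqrt (‖w z.1 z.2‖ ^ 2 + ε ^ 2)) (S ×ˢ univ) :=
  ((hw.norm.pow 2).add continuousOn_const).sqrt

/-- **Time integration of `∫ φ ⟪w, ∂ₜw⟫/N`.** For a field `w` jointly smooth on `[0, T'] × ℝ³`,
`T' > 0`, a continuous compactly supported weight `φ`, `ε ≠ 0`, `N = √(|w|² + ε²)` and any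
constant `c`:
`∫₀^{T'} ∫ φ ⟪w, ∂ₜw⟫/N dx dτ = ∫ φ (N(T') − c) − ∫ φ (N(0) − c)`
(Fubini on `(0, T') × ℝ³` and the fundamental theorem of calculus on each time line, where
`∂ₜ(N ∘ w) = ⟪w, ∂ₜw⟫/N`; Constantin 1990, the time integration of (2.9)). [folklore] -/
theorem integral_Ioo_integral_mul_inner_timeDerivWithin_div_regN
    (hw : IsSmoothSpaceTimeOn (Icc 0 T') w) (hT' : 0 < T') {φ : (EuclideanSpace ℝ (Fin 3)) → ℝ} (hφ : Continuous φ)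
    (hc : HasCompactSupport φ) {ε : ℝ} (hε : ε ≠ 0) (c : ℝ) :
    ∫ τ in Ioo 0 T', ∫ x, φ x *
        (⟪w τ x, FluidPDE.timeDerivWithin (Icc 0 T') w τ x⟫ / Real.sqrt (‖w τ x‖ ^ 2 + ε ^ 2)) =
      (∫ x, φ x * (Real.sqrt (‖w T' x‖ ^ 2 + ε ^ 2) - c)) - ∫ x, φ x * (Real.sqrt (‖w 0 x‖ ^ 2 + ε ^ 2) - c) := by
  have hU : UniqueDiffOn ℝ (Icc 0 T') := uniqueDiffOn_Icc hT'
  have hw_cont : ContinuousOn (uncurry w) (Icc 0 T' ×ˢ univ) := hw.continuousOn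
  have hdt_cont : ContinuousOn (uncurry (FluidPDE.timeDerivWithin (Icc 0 T') w))
      (Icc 0 T' ×ˢ univ) := (hw.timeDerivWithin hU).continuousOn
  have hN_cont := continuousOn_regN_uncurry hw_cont ε
  have hNne : ∀ z : ℝ × (EuclideanSpace ℝ (Fin 3)), Real.sqrt (‖w z.1 z.2‖ ^ 2 + ε ^ 2) ≠ 0 := fun z => (regN_pos hε _).ne'
  have hKφ : ∀ x ∉ tsupport φ, φ x = 0 := fun x hx => image_eq_zero_of_notMem_tsupport hx
  set D : ℝ × (EuclideanSpace ℝ (Fin 3)) → ℝ := fun z => φ z.2 *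
    (⟪w z.1 z.2, FluidPDE.timeDerivWithin (Icc 0 T') w z.1 z.2⟫ / Real.sqrt (‖w z.1 z.2‖ ^ 2 + ε ^ 2)) with hD
  have hDcont : ContinuousOn D (Icc 0 T' ×ˢ univ) :=
    (hφ.comp continuous_snd).continuousOn.mul ((hw_cont.inner hdt_cont).div hN_cont
      fun z _ => hNne z)
  have hDK : ∀ τ ∈ Icc 0 T', ∀ x ∉ tsupport φ, D (τ, x) = 0 := fun τ _ x hx => by
    simp [hD, hKφ x hx]
  have hDint := integrable_prod_of_continuousOn hc hDcont hDK
  have hswap := integral_integral_swap (f := fun τ x => D (τ, x)) hDint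
  simp only [hD] at hswap
  rw [hswap]
  have hslice : ∀ {r : ℝ}, r ∈ Icc 0 T' →
      Integrable (fun x => φ x * (Real.sqrt (‖w r x‖ ^ 2 + ε ^ 2) - c)) (volume : Measure (EuclideanSpace ℝ (Fin 3))) := fun hr =>
    (hφ.mul ((((hw.contDiff_slice hr).continuous.norm.pow 2).add continuous_const).sqrt.sub
      continuous_const)).integrable_of_hasCompactSupport hc.mul_right
  have hTI : T' ∈ Icc 0 T' := ⟨hT'.le, le_rfl⟩
  have h0I : (0 : ℝ) ∈ Icc 0 T' := ⟨le_rfl, hT'.le⟩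
  have hline : ∀ x, ∫ τ in Ioo 0 T', φ x *
      (⟪w τ x, FluidPDE.timeDerivWithin (Icc 0 T') w τ x⟫ / Real.sqrt (‖w τ x‖ ^ 2 + ε ^ 2)) =
      φ x * (Real.sqrt (‖w T' x‖ ^ 2 + ε ^ 2) - c) - φ x * (Real.sqrt (‖w 0 x‖ ^ 2 + ε ^ 2) - c) := by
    intro x
    have hwx : ContinuousOn (fun τ => w τ x) (Icc 0 T') :=
      hw_cont.comp (Continuous.prodMk_left x).continuousOn
        fun τ hτ => mk_mem_prod hτ (mem_univ x)
    have hcont : ContinuousOn (fun τ => φ x * (Real.sqrt (‖w τ x‖ ^ 2 + ε ^ 2) - c)) (Icc 0 T') :=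
      continuousOn_const.mul (((hwx.norm.pow 2).add continuousOn_const).sqrt.sub
        continuousOn_const)
    have hderiv : ∀ τ ∈ Ioo 0 T', HasDerivWithinAt (fun τ => φ x * (Real.sqrt (‖w τ x‖ ^ 2 + ε ^ 2) - c))
        (φ x * (⟪w τ x, FluidPDE.timeDerivWithin (Icc 0 T') w τ x⟫ / Real.sqrt (‖w τ x‖ ^ 2 + ε ^ 2)))
        (Ioi τ) τ := by
      intro τ hτ
      have hw' : HasDerivAt (fun σ => w σ x) (FluidPDE.timeDerivWithin (Icc 0 T') w τ x) τ :=
        (hw.hasDerivWithinAt_timeDerivWithin hU (Ioo_subset_Icc_self hτ) x).hasDerivAt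
          (Icc_mem_nhds hτ.1 hτ.2)
      have hne : ‖w τ x‖ ^ 2 + ε ^ 2 ≠ 0 := by positivity
      have h1 : HasDerivAt (fun σ => ‖w σ x‖ ^ 2 + ε ^ 2)
          (2 * ⟪w τ x, FluidPDE.timeDerivWithin (Icc 0 T') w τ x⟫) τ :=
        hw'.norm_sq.add_const _
      have h2 := ((h1.sqrt hne).sub_const c).const_mul (φ x)
      refine (h2.hasDerivWithinAt (s := Ioi τ)).congr_deriv ?_
      have hN : Real.sqrt (‖w τ x‖ ^ 2 + ε ^ 2) ≠ 0 := (regN_pos hε _).ne'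
      field_simp
    have hint : IntervalIntegrable (fun τ => φ x *
        (⟪w τ x, FluidPDE.timeDerivWithin (Icc 0 T') w τ x⟫ / Real.sqrt (‖w τ x‖ ^ 2 + ε ^ 2))) volume 0 T' := by
      refine ContinuousOn.intervalIntegrable ?_
      rw [uIcc_of_le hT'.le]
      exact hDcont.comp (Continuous.prodMk_left x).continuousOn
        fun τ hτ => mk_mem_prod hτ (mem_univ x)
    have := intervalIntegral.integral_eq_sub_of_hasDeriv_right_of_le hT'.le hcont hderiv hint
    rw [intervalIntegral.integral_of_le hT'.le, integral_Ioc_eq_integral_Ioo] at this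
    rw [this]
  rw [integral_congr_ae (Eventually.of_forall hline), integral_sub (hslice hTI) (hslice h0I)]

end Time

/-! ### The slice identity for a classical solution on a closed slab -/

section Assembly

variable {ν T' : ℝ} {u : ℝ → (EuclideanSpace ℝ (Fin 3)) → (EuclideanSpace ℝ (Fin 3))} {p : ℝ → (EuclideanSpace ℝ (Fin 3)) → ℝ}

/-- The vorticity of a classical solution is a jointly smooth field (`curl = curlCLM ∘ D`). [folklore] -/
theorem IsClassicalNSSolutionOn.isSmoothSpaceTimeOn_vorticity {S : Set ℝ} {f : ℝ → (EuclideanSpace ℝ (Fin 3)) → (EuclideanSpace ℝ (Fin 3))}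
    (hns : IsClassicalNSSolutionOn S ν f u p) (hS : UniqueDiffOn ℝ S) :
    IsSmoothSpaceTimeOn S (vorticity u) :=
  (hns.smooth_velocity.fderiv_slice hS).clm_comp curlCLM

/-- The vorticity slices of a classical solution are `C²`. [folklore] -/
theorem IsClassicalNSSolutionOn.contDiff_two_vorticity {S : Set ℝ} {f : ℝ → (EuclideanSpace ℝ (Fin 3)) → (EuclideanSpace ℝ (Fin 3))}
    (hns : IsClassicalNSSolutionOn S ν f u p) {t : ℝ} (ht : t ∈ S) :
    ContDiff ℝ 2 (vorticity u t) := by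
  have h3 : ContDiff ℝ 3 (u t) := contDiff_infty.1 (hns.contDiff_velocity ht) 3
  exact contDiff_curl (n := 2) (by exact_mod_cast h3)

/-- **The slice identity** (the `ℝ³`, cut-off form of Constantin 1990, (2.9) for
`q(y) = √(1 + |y|²)`, integrated in space): for a classical solution of the unforced
Navier–Stokes equations on `[0, T'] × ℝ³`, `T' > 0`, `τ ∈ [0, T']`, `φ ∈ C²_c`, `ε ≠ 0`,
`ω = curl u(τ)`, `N = √(|ω|² + ε²)`,
`∫ φ ⟪ω, ∂ₜω⟫/N = −ν ∫ φ Dreg_ε + ∫ [ν (Δφ)(N − ε) + (N − ε) (u·∇)φ + φ ⟪ω, (ω·∇)u⟫/N]`: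
insert the vorticity equation `∂ₜω = νΔω − (u·∇)ω + (ω·∇)u` (`VorticityEquation`) and use the
viscous and transport identities of the calculus file. [folklore] -/
theorem IsClassicalNSSolutionOn.integral_mul_inner_timeDerivWithin_vorticity_div_regN
    (hns : IsClassicalNSSolutionOn (Icc 0 T') ν 0 u p) (hT' : 0 < T') {τ : ℝ} (hτ : τ ∈ Icc 0 T')
    {φ : (EuclideanSpace ℝ (Fin 3)) → ℝ} (hφ : ContDiff ℝ 2 φ) (hφc : HasCompactSupport φ) {ε : ℝ} (hε : ε ≠ 0) :
    ∫ x, φ x * (⟪vorticity u τ x, FluidPDE.timeDerivWithin (Icc 0 T') (vorticity u) τ x⟫ /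
        Real.sqrt (‖vorticity u τ x‖ ^ 2 + ε ^ 2)) =
      -(ν * ∫ x, φ x * (∑ i, (‖fderiv ℝ (vorticity u τ) x ((stdOrthonormalBasis ℝ (EuclideanSpace ℝ (Fin 3))) i)‖ ^ 2 / Real.sqrt (‖(vorticity u τ) x‖ ^ 2 + ε ^ 2) - ⟪(vorticity u τ) x, fderiv ℝ (vorticity u τ) x ((stdOrthonormalBasis ℝ (EuclideanSpace ℝ (Fin 3))) i)⟫ ^ 2 / Real.sqrt (‖(vorticity u τ) x‖ ^ 2 + ε ^ 2) ^ 3))) +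
      ∫ x, (ν * ((Δ φ) x * (Real.sqrt (‖vorticity u τ x‖ ^ 2 + ε ^ 2) - ε))
        + (Real.sqrt (‖vorticity u τ x‖ ^ 2 + ε ^ 2) - ε) * fderiv ℝ φ x (u τ x)
        + φ x * (⟪vorticity u τ x, fderiv ℝ (u τ) x (vorticity u τ x)⟫ /
            Real.sqrt (‖vorticity u τ x‖ ^ 2 + ε ^ 2))) := by
  have hU : UniqueDiffOn ℝ (Icc 0 T') := uniqueDiffOn_Icc hT'
  have hcl : Icc 0 T' ⊆ closure (interior (Icc 0 T')) := by
    rw [interior_Icc, closure_Ioo hT'.ne]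
  set ω := vorticity u τ with hωdef
  have hω : ContDiff ℝ 2 ω := hns.contDiff_two_vorticity hτ
  have hω1 : ContDiff ℝ 1 ω := hω.of_le one_le_two
  have hu1 : ContDiff ℝ 1 (u τ) := (hns.contDiff_velocity hτ).of_le (by exact_mod_cast le_top)
  have hφ1 : ContDiff ℝ 1 φ := hφ.of_le one_le_two
  have hNne : ∀ y, Real.sqrt (‖ω y‖ ^ 2 + ε ^ 2) ≠ 0 := fun y => (regN_pos hε _).ne'
  -- the vorticity equation, solved for `∂ₜω`
  have hV : ∀ x, FluidPDE.timeDerivWithin (Icc 0 T') (vorticity u) τ x =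
      ν • (Δ ω) x - fderiv ℝ ω x (u τ x) + fderiv ℝ (u τ) x (ω x) := by
    intro x
    have h := hns.vorticity_eq hU hcl (fun _ _ x => curl_zero x) hτ x
    simp only [convect_apply] at h
    rw [hωdef]
    rw [← sub_eq_zero] at h ⊢
    rw [← h]
    abel
  -- pointwise splitting of the integrand
  have hpt : ∀ x, φ x * (⟪ω x, FluidPDE.timeDerivWithin (Icc 0 T') (vorticity u) τ x⟫ /
      Real.sqrt (‖ω x‖ ^ 2 + ε ^ 2)) =
      ν * (φ x * (⟪ω x, (Δ ω) x⟫ / Real.sqrt (‖ω x‖ ^ 2 + ε ^ 2)))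
        - φ x * (⟪ω x, fderiv ℝ ω x (u τ x)⟫ / Real.sqrt (‖ω x‖ ^ 2 + ε ^ 2))
        + φ x * (⟪ω x, fderiv ℝ (u τ) x (ω x)⟫ / Real.sqrt (‖ω x‖ ^ 2 + ε ^ 2)) := by
    intro x
    rw [hV x, inner_add_right, inner_sub_right, real_inner_smul_right]
    ring
  -- integrability of the three pieces (continuous, compact support in `x`)
  have hcω : Continuous ω := hω.continuous
  have hcN : Continuous fun x => Real.sqrt (‖ω x‖ ^ 2 + ε ^ 2) := ((contDiff_regN hε (n := 1)).comp hω1).continuous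
  have hcΔ : Continuous (Δ ω) := continuous_laplacian hω
  have hcDω : Continuous fun x => fderiv ℝ ω x (u τ x) :=
    (hω1.continuous_fderiv one_ne_zero).clm_apply hu1.continuous
  have hcDu : Continuous fun x => fderiv ℝ (u τ) x (ω x) :=
    (hu1.continuous_fderiv one_ne_zero).clm_apply hcω
  have hi₁ : Integrable fun x => φ x * (⟪ω x, (Δ ω) x⟫ / Real.sqrt (‖ω x‖ ^ 2 + ε ^ 2)) :=
    (hφ.continuous.mul ((hcω.inner hcΔ).div hcN hNne)).integrable_of_hasCompactSupport
      hφc.mul_right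
  have hi₂ : Integrable fun x => φ x * (⟪ω x, fderiv ℝ ω x (u τ x)⟫ / Real.sqrt (‖ω x‖ ^ 2 + ε ^ 2)) :=
    (hφ.continuous.mul ((hcω.inner hcDω).div hcN hNne)).integrable_of_hasCompactSupport
      hφc.mul_right
  have hi₃ : Integrable fun x => φ x * (⟪ω x, fderiv ℝ (u τ) x (ω x)⟫ / Real.sqrt (‖ω x‖ ^ 2 + ε ^ 2)) :=
    (hφ.continuous.mul ((hcω.inner hcDu).div hcN hNne)).integrable_of_hasCompactSupport
      hφc.mul_right
  -- the two identities of the calculus file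
  have hvisc := integral_mul_inner_laplacian_div_regN hω hφ hφc hε ε
  have htrans := integral_mul_inner_convect_div_regN hω1 hφ1 hφc hε hu1 (hns.divFree τ hτ) ε
  -- integrability of the remainder pieces
  have hΔc : HasCompactSupport (Δ φ) :=
    HasCompactSupport.intro hφc fun x hx => laplacian_eq_zero_of_notMem_tsupport hx
  have hr₁ : Integrable fun x => ν * ((Δ φ) x * (Real.sqrt (‖ω x‖ ^ 2 + ε ^ 2) - ε)) :=
    (((continuous_laplacian hφ).mul (hcN.sub continuous_const)).integrable_of_hasCompactSupport
      hΔc.mul_right).const_mul ν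
  have hr₂ : Integrable fun x => (Real.sqrt (‖ω x‖ ^ 2 + ε ^ 2) - ε) * fderiv ℝ φ x (u τ x) := by
    refine ((hcN.sub continuous_const).mul
      ((hφ1.continuous_fderiv one_ne_zero).clm_apply hu1.continuous)).integrable_of_hasCompactSupport ?_
    refine (hφc.fderiv (𝕜 := ℝ)).mono fun x hx => ?_
    contrapose! hx
    simp only [mem_support, not_not] at hx
    simp [hx]
  -- assemble
  have step1 : ∫ x, φ x * (⟪ω x, FluidPDE.timeDerivWithin (Icc 0 T') (vorticity u) τ x⟫ / Real.sqrt (‖ω x‖ ^ 2 + ε ^ 2))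
      = ∫ x, (ν * (φ x * (⟪ω x, (Δ ω) x⟫ / Real.sqrt (‖ω x‖ ^ 2 + ε ^ 2)))
          - φ x * (⟪ω x, fderiv ℝ ω x (u τ x)⟫ / Real.sqrt (‖ω x‖ ^ 2 + ε ^ 2))
          + φ x * (⟪ω x, fderiv ℝ (u τ) x (ω x)⟫ / Real.sqrt (‖ω x‖ ^ 2 + ε ^ 2))) :=
    integral_congr_ae (Eventually.of_forall hpt)
  rw [step1, integral_add ?_ hi₃, integral_sub ?_ hi₂, integral_const_mul, hvisc, htrans,
    integral_add ?_ hi₃, integral_add hr₁ hr₂, integral_const_mul]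
  · ring
  · exact hr₁.add hr₂
  · exact hi₁.const_mul ν
  · exact (hi₁.const_mul ν).sub hi₂

/-! ### Slab functions: continuity of parametric integrals, integrability -/

/-- A function continuous on the slab `[0, T'] × ℝ³` and vanishing for `x` off a compact set has
continuous space integrals `τ ↦ ∫ H τ x dx` on `[0, T']` (Mathlib
`continuousOn_integral_of_compact_support`), hence integrable ones on `(0, T')`. [folklore] -/
theorem integrableOn_Ioo_integral_of_continuousOn {H : ℝ → (EuclideanSpace ℝ (Fin 3)) → ℝ} {K : Set (EuclideanSpace ℝ (Fin 3))} (hK : IsCompact K)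
    (hH : ContinuousOn (uncurry H) (Icc 0 T' ×ˢ univ)) (hHK : ∀ τ ∈ Icc 0 T', ∀ x ∉ K, H τ x = 0) :
    IntegrableOn (fun τ => ∫ x, H τ x) (Ioo 0 T') :=
  ((continuousOn_integral_of_compact_support hK hH fun τ x hτ hx => hHK τ hτ x hx).integrableOn_Icc
    (μ := volume)).mono_set Ioo_subset_Icc_self

/-- Slices of such a function are integrable (continuous with compact support). [folklore] -/
theorem integrable_slice_of_continuousOn {H : ℝ → (EuclideanSpace ℝ (Fin 3)) → ℝ} {K : Set (EuclideanSpace ℝ (Fin 3))} (hK : IsCompact K)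
    (hH : ContinuousOn (uncurry H) (Icc 0 T' ×ˢ univ)) (hHK : ∀ τ ∈ Icc 0 T', ∀ x ∉ K, H τ x = 0)
    {τ : ℝ} (hτ : τ ∈ Icc 0 T') : Integrable (H τ) := by
  have hc : Continuous (H τ) :=
    hH.comp_continuous (Continuous.prodMk_right τ) fun x => mk_mem_prod hτ (mem_univ x)
  exact hc.integrable_of_hasCompactSupport (HasCompactSupport.intro hK (hHK τ hτ))

variable {w : ℝ → (EuclideanSpace ℝ (Fin 3)) → (EuclideanSpace ℝ (Fin 3))}

/-- Joint continuity of the regularised direction dissipation `Dreg_ε(w(τ), x)` of a jointly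
smooth field on `S × ℝ³`, `S` of unique differentiability (`ε ≠ 0`). [folklore] -/
theorem continuousOn_dirDissReg_slab {S : Set ℝ} (hw : IsSmoothSpaceTimeOn S w)
    (hS : UniqueDiffOn ℝ S) {ε : ℝ} (hε : ε ≠ 0) :
    ContinuousOn (fun z : ℝ × (EuclideanSpace ℝ (Fin 3)) => (∑ i, (‖fderiv ℝ (w z.1) z.2 ((stdOrthonormalBasis ℝ (EuclideanSpace ℝ (Fin 3))) i)‖ ^ 2 / Real.sqrt (‖(w z.1) z.2‖ ^ 2 + ε ^ 2) - ⟪(w z.1) z.2, fderiv ℝ (w z.1) z.2 ((stdOrthonormalBasis ℝ (EuclideanSpace ℝ (Fin 3))) i)⟫ ^ 2 / Real.sqrt (‖(w z.1) z.2‖ ^ 2 + ε ^ 2) ^ 3))) (S ×ˢ univ) := by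
  have hw_c : ContinuousOn (uncurry w) (S ×ˢ univ) := hw.continuousOn
  have hDw_c : ContinuousOn (uncurry fun τ x => fderiv ℝ (w τ) x) (S ×ˢ univ) :=
    (hw.fderiv_slice hS).continuousOn
  have hN_c := continuousOn_regN_uncurry hw_c ε
  have hNne : ∀ z ∈ S ×ˢ (univ : Set (EuclideanSpace ℝ (Fin 3))), Real.sqrt (‖w z.1 z.2‖ ^ 2 + ε ^ 2) ≠ 0 :=
    fun z _ => (regN_pos hε _).ne'
  refine continuousOn_finsetSum _ fun i _ => ?_
  have hDi : ContinuousOn (fun z : ℝ × (EuclideanSpace ℝ (Fin 3)) => fderiv ℝ (w z.1) z.2 (stdOrthonormalBasis ℝ (EuclideanSpace ℝ (Fin 3)) i))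
      (S ×ˢ univ) := hDw_c.clm_apply continuousOn_const
  exact ((hDi.norm.pow 2).div hN_c hNne).sub
    (((hw_c.inner hDi).pow 2).div (hN_c.pow 3) fun z hz => pow_ne_zero 3 (hNne z hz))

/-- Joint continuity of the lower density `Dlow_ε(w(τ), x)` on `S × ℝ³` (`ε ≠ 0`). [folklore] -/
theorem continuousOn_dirDissLow_slab {S : Set ℝ} (hw : IsSmoothSpaceTimeOn S w)
    (hS : UniqueDiffOn ℝ S) {ε : ℝ} (hε : ε ≠ 0) :
    ContinuousOn (fun z : ℝ × (EuclideanSpace ℝ (Fin 3)) => ((∑ i, (‖fderiv ℝ (w z.1) z.2 ((stdOrthonormalBasis ℝ (EuclideanSpace ℝ (Fin 3))) i)‖ ^ 2 * ‖(w z.1) z.2‖ ^ 2 - ⟪(w z.1) z.2, fderiv ℝ (w z.1) z.2 ((stdOrthonormalBasis ℝ (EuclideanSpace ℝ (Fin 3))) i)⟫ ^ 2)) / Real.sqrt (‖(w z.1) z.2‖ ^ 2 + ε ^ 2) ^ 3)) (S ×ˢ univ) := by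
  have hw_c : ContinuousOn (uncurry w) (S ×ˢ univ) := hw.continuousOn
  have hDw_c : ContinuousOn (uncurry fun τ x => fderiv ℝ (w τ) x) (S ×ˢ univ) :=
    (hw.fderiv_slice hS).continuousOn
  have hN_c := continuousOn_regN_uncurry hw_c ε
  have hNne : ∀ z ∈ S ×ˢ (univ : Set (EuclideanSpace ℝ (Fin 3))), Real.sqrt (‖w z.1 z.2‖ ^ 2 + ε ^ 2) ≠ 0 :=
    fun z _ => (regN_pos hε _).ne'
  refine ContinuousOn.div ?_ (hN_c.pow 3) fun z hz => pow_ne_zero 3 (hNne z hz)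
  refine continuousOn_finsetSum _ fun i _ => ?_
  have hDi : ContinuousOn (fun z : ℝ × (EuclideanSpace ℝ (Fin 3)) => fderiv ℝ (w z.1) z.2 (stdOrthonormalBasis ℝ (EuclideanSpace ℝ (Fin 3)) i))
      (S ×ˢ univ) := hDw_c.clm_apply continuousOn_const
  exact ((hDi.norm.pow 2).mul (hw_c.norm.pow 2)).sub ((hw_c.inner hDi).pow 2)

/-! ### The slab inequality -/

/-- **The slab inequality** (Constantin 1990, (2.9) integrated over `(0, T') × ℝ³` against a
cut-off, the direction-dissipation term kept and the end-time term dropped): for a classical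
solution of the unforced Navier–Stokes equations on `[0, T'] × ℝ³` (`T' > 0`, `ν ≥ 0`), a
nonnegative `φ ∈ C²_c` and `ε > 0`,
`ν ∫₀^{T'}∫ φ Dlow_ε ≤ ∫ φ |ω(0)| + |∫₀^{T'}∫ rest|`,
`rest = ν (Δφ)(N − ε) + (N − ε)(u·∇)φ + φ ⟪ω, (ω·∇)u⟫/N`: integrate the slice identity in time
(`integral_Ioo_integral_mul_inner_timeDerivWithin_div_regN`), drop `∫ φ (N(T') − ε) ≥ 0`, bound
`∫ φ (N(0) − ε) ≤ ∫ φ |ω(0)|`, and use `0 ≤ Dlow_ε ≤ Dreg_ε`. [folklore] -/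
theorem IsClassicalNSSolutionOn.direction_dissipation_slab_le
    (hns : IsClassicalNSSolutionOn (Icc 0 T') ν 0 u p) (hT' : 0 < T') (hν : 0 ≤ ν)
    {φ : (EuclideanSpace ℝ (Fin 3)) → ℝ} (hφ : ContDiff ℝ 2 φ) (hφc : HasCompactSupport φ) (hφ0 : ∀ x, 0 ≤ φ x)
    {ε : ℝ} (hε : 0 < ε) :
    ν * ∫ τ in Ioo 0 T', ∫ x, φ x * ((∑ i, (‖fderiv ℝ (vorticity u τ) x ((stdOrthonormalBasis ℝ (EuclideanSpace ℝ (Fin 3))) i)‖ ^ 2 * ‖(vorticity u τ) x‖ ^ 2 - ⟪(vorticity u τ) x, fderiv ℝ (vorticity u τ) x ((stdOrthonormalBasis ℝ (EuclideanSpace ℝ (Fin 3))) i)⟫ ^ 2)) / Real.sqrt (‖(vorticity u τ) x‖ ^ 2 + ε ^ 2) ^ 3) ≤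
      (∫ x, φ x * ‖vorticity u 0 x‖) +
      |∫ τ in Ioo 0 T', ∫ x, (ν * ((Δ φ) x * (Real.sqrt (‖vorticity u τ x‖ ^ 2 + ε ^ 2) - ε))
        + (Real.sqrt (‖vorticity u τ x‖ ^ 2 + ε ^ 2) - ε) * fderiv ℝ φ x (u τ x)
        + φ x * (⟪vorticity u τ x, fderiv ℝ (u τ) x (vorticity u τ x)⟫ /
            Real.sqrt (‖vorticity u τ x‖ ^ 2 + ε ^ 2)))| := by
  have hU : UniqueDiffOn ℝ (Icc 0 T') := uniqueDiffOn_Icc hT'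
  have hε0 : ε ≠ 0 := hε.ne'
  set w := vorticity u with hwdef
  have hw : IsSmoothSpaceTimeOn (Icc 0 T') w := hns.isSmoothSpaceTimeOn_vorticity hU
  -- joint continuity of the building blocks
  have hw_c : ContinuousOn (uncurry w) (Icc 0 T' ×ˢ univ) := hw.continuousOn
  have hdt_c : ContinuousOn (uncurry (FluidPDE.timeDerivWithin (Icc 0 T') w)) (Icc 0 T' ×ˢ univ) :=
    (hw.timeDerivWithin hU).continuousOn
  have hu_c : ContinuousOn (uncurry u) (Icc 0 T' ×ˢ univ) := hns.smooth_velocity.continuousOn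
  have hDu_c : ContinuousOn (uncurry fun τ x => fderiv ℝ (u τ) x) (Icc 0 T' ×ˢ univ) :=
    (hns.smooth_velocity.fderiv_slice hU).continuousOn
  have hN_c := continuousOn_regN_uncurry hw_c ε
  have hNne : ∀ z ∈ Icc 0 T' ×ˢ (univ : Set (EuclideanSpace ℝ (Fin 3))), Real.sqrt (‖w z.1 z.2‖ ^ 2 + ε ^ 2) ≠ 0 :=
    fun z _ => (regN_pos hε0 _).ne'
  have hφ_c : ContinuousOn (fun z : ℝ × (EuclideanSpace ℝ (Fin 3)) => φ z.2) (Icc 0 T' ×ˢ univ) :=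
    (hφ.continuous.comp continuous_snd).continuousOn
  have hK : IsCompact (tsupport φ) := hφc
  have hKφ : ∀ x ∉ tsupport φ, φ x = 0 := fun x hx => image_eq_zero_of_notMem_tsupport hx
  -- the four slab functions
  set L : ℝ → (EuclideanSpace ℝ (Fin 3)) → ℝ := fun τ x => φ x *
    (⟪w τ x, FluidPDE.timeDerivWithin (Icc 0 T') w τ x⟫ / Real.sqrt (‖w τ x‖ ^ 2 + ε ^ 2)) with hL
  set P : ℝ → (EuclideanSpace ℝ (Fin 3)) → ℝ := fun τ x => φ x * (∑ i, (‖fderiv ℝ (w τ) x ((stdOrthonormalBasis ℝ (EuclideanSpace ℝ (Fin 3))) i)‖ ^ 2 / Real.sqrt (‖(w τ) x‖ ^ 2 + ε ^ 2) - ⟪(w τ) x, fderiv ℝ (w τ) x ((stdOrthonormalBasis ℝ (EuclideanSpace ℝ (Fin 3))) i)⟫ ^ 2 / Real.sqrt (‖(w τ) x‖ ^ 2 + ε ^ 2) ^ 3)) with hP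
  set Q : ℝ → (EuclideanSpace ℝ (Fin 3)) → ℝ := fun τ x => φ x * ((∑ i, (‖fderiv ℝ (w τ) x ((stdOrthonormalBasis ℝ (EuclideanSpace ℝ (Fin 3))) i)‖ ^ 2 * ‖(w τ) x‖ ^ 2 - ⟪(w τ) x, fderiv ℝ (w τ) x ((stdOrthonormalBasis ℝ (EuclideanSpace ℝ (Fin 3))) i)⟫ ^ 2)) / Real.sqrt (‖(w τ) x‖ ^ 2 + ε ^ 2) ^ 3) with hQ
  set Rr : ℝ → (EuclideanSpace ℝ (Fin 3)) → ℝ := fun τ x => ν * ((Δ φ) x * (Real.sqrt (‖w τ x‖ ^ 2 + ε ^ 2) - ε))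
    + (Real.sqrt (‖w τ x‖ ^ 2 + ε ^ 2) - ε) * fderiv ℝ φ x (u τ x)
    + φ x * (⟪w τ x, fderiv ℝ (u τ) x (w τ x)⟫ / Real.sqrt (‖w τ x‖ ^ 2 + ε ^ 2)) with hRr
  have hLc : ContinuousOn (uncurry L) (Icc 0 T' ×ˢ univ) :=
    hφ_c.mul ((hw_c.inner hdt_c).div hN_c hNne)
  have hPc : ContinuousOn (uncurry P) (Icc 0 T' ×ˢ univ) :=
    hφ_c.mul (continuousOn_dirDissReg_slab hw hU hε0)
  have hQc : ContinuousOn (uncurry Q) (Icc 0 T' ×ˢ univ) :=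
    hφ_c.mul (continuousOn_dirDissLow_slab hw hU hε0)
  have hRc : ContinuousOn (uncurry Rr) (Icc 0 T' ×ˢ univ) := by
    refine ((continuousOn_const.mul (((continuous_laplacian hφ).comp continuous_snd).continuousOn.mul
      (hN_c.sub continuousOn_const))).add ((hN_c.sub continuousOn_const).mul ?_)).add
      (hφ_c.mul ((hw_c.inner (hDu_c.clm_apply hw_c)).div hN_c hNne))
    exact (((hφ.continuous_fderiv (by norm_num)).comp continuous_snd).continuousOn).clm_apply hu_c
  have hLK : ∀ τ ∈ Icc 0 T', ∀ x ∉ tsupport φ, L τ x = 0 := fun τ _ x hx => by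
    simp [hL, hKφ x hx]
  have hPK : ∀ τ ∈ Icc 0 T', ∀ x ∉ tsupport φ, P τ x = 0 := fun τ _ x hx => by
    simp only [hP, hKφ x hx, zero_mul]
  have hQK : ∀ τ ∈ Icc 0 T', ∀ x ∉ tsupport φ, Q τ x = 0 := fun τ _ x hx => by
    simp only [hQ, hKφ x hx, zero_mul]
  have hRK : ∀ τ ∈ Icc 0 T', ∀ x ∉ tsupport φ, Rr τ x = 0 := fun τ _ x hx => by
    simp only [hRr, hKφ x hx, laplacian_eq_zero_of_notMem_tsupport hx,
      fderiv_of_notMem_tsupport ℝ hx]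
    simp
  -- integrability in time of the space integrals
  have hPi := integrableOn_Ioo_integral_of_continuousOn hK hPc hPK
  have hQi := integrableOn_Ioo_integral_of_continuousOn hK hQc hQK
  have hRi := integrableOn_Ioo_integral_of_continuousOn hK hRc hRK
  -- the slice identity, for every `τ ∈ [0, T']`
  have hE1 : ∀ τ ∈ Icc 0 T', ∫ x, L τ x = -(ν * ∫ x, P τ x) + ∫ x, Rr τ x := fun τ hτ =>
    hns.integral_mul_inner_timeDerivWithin_vorticity_div_regN hT' hτ hφ hφc hε0
  -- time integration of the left-hand side
  have hD := integral_Ioo_integral_mul_inner_timeDerivWithin_div_regN hw hT' hφ.continuous hφc hε0 ε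
  have hcongr : ∫ τ in Ioo 0 T', ∫ x, L τ x = ∫ τ in Ioo 0 T', (-(ν * ∫ x, P τ x) + ∫ x, Rr τ x) :=
    setIntegral_congr_fun measurableSet_Ioo fun τ hτ => hE1 τ (Ioo_subset_Icc_self hτ)
  have hsplit : ∫ τ in Ioo 0 T', (-(ν * ∫ x, P τ x) + ∫ x, Rr τ x) =
      -(ν * ∫ τ in Ioo 0 T', ∫ x, P τ x) + ∫ τ in Ioo 0 T', ∫ x, Rr τ x := by
    rw [integral_add ?_ hRi, integral_neg, integral_const_mul]
    exact (hPi.const_mul ν).neg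
  -- signs of the end terms
  have hA1 : 0 ≤ ∫ x, φ x * (Real.sqrt (‖w T' x‖ ^ 2 + ε ^ 2) - ε) :=
    integral_nonneg fun x => mul_nonneg (hφ0 x) (regN_sub_nonneg hε.le _)
  have hA0 : ∫ x, φ x * (Real.sqrt (‖w 0 x‖ ^ 2 + ε ^ 2) - ε) ≤ ∫ x, φ x * ‖w 0 x‖ := by
    have h0I : (0 : ℝ) ∈ Icc 0 T' := ⟨le_rfl, hT'.le⟩
    have hc0 : Continuous (w 0) := (hw.contDiff_slice h0I).continuous
    refine integral_mono ?_ ?_ fun x => ?_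
    · exact (hφ.continuous.mul ((((hc0.norm.pow 2).add continuous_const).sqrt).sub
        continuous_const)).integrable_of_hasCompactSupport hφc.mul_right
    · exact (hφ.continuous.mul hc0.norm).integrable_of_hasCompactSupport hφc.mul_right
    · exact mul_le_mul_of_nonneg_left (regN_sub_le_norm hε.le _) (hφ0 x)
  -- `Dlow ≤ Dreg` under the integrals
  have hQP : ∫ τ in Ioo 0 T', ∫ x, Q τ x ≤ ∫ τ in Ioo 0 T', ∫ x, P τ x := by
    refine integral_mono_ae hQi hPi ?_
    filter_upwards [ae_restrict_mem measurableSet_Ioo] with τ hτ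
    have hτ' : τ ∈ Icc 0 T' := Ioo_subset_Icc_self hτ
    refine integral_mono (integrable_slice_of_continuousOn hK hQc hQK hτ')
      (integrable_slice_of_continuousOn hK hPc hPK hτ') fun x => ?_
    exact mul_le_mul_of_nonneg_left (dirDissLow_le_dirDissReg hε0 _ _) (hφ0 x)
  -- conclude
  have key : ν * ∫ τ in Ioo 0 T', ∫ x, P τ x =
      (∫ τ in Ioo 0 T', ∫ x, Rr τ x) - (∫ x, φ x * (Real.sqrt (‖w T' x‖ ^ 2 + ε ^ 2) - ε))
        + ∫ x, φ x * (Real.sqrt (‖w 0 x‖ ^ 2 + ε ^ 2) - ε) := by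
    have := hD
    rw [hcongr, hsplit] at this
    linarith
  calc ν * ∫ τ in Ioo 0 T', ∫ x, Q τ x ≤ ν * ∫ τ in Ioo 0 T', ∫ x, P τ x :=
        mul_le_mul_of_nonneg_left hQP hν
    _ ≤ (∫ x, φ x * ‖w 0 x‖) + |∫ τ in Ioo 0 T', ∫ x, Rr τ x| := by
        rw [key]
        linarith [le_abs_self (∫ τ in Ioo 0 T', ∫ x, Rr τ x)]

/-! ### The remainder: pointwise bound and the space–time `L²` bound -/

/-- Young's inequality in the form used for the Laplacian tail: `t ≤ λ t²/2 + 1/(2λ)` for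
`t ≥ 0`, `λ > 0`. [folklore] -/
theorem le_mul_sq_add_inv {t lam : ℝ} (hlam : 0 < lam) : t ≤ lam * t ^ 2 / 2 + 1 / (2 * lam) := by
  have h : 0 ≤ lam * (t - 1 / lam) ^ 2 / 2 := by positivity
  have e : lam * (t - 1 / lam) ^ 2 / 2 = lam * t ^ 2 / 2 + 1 / (2 * lam) - t := by
    field_simp
    ring
  linarith

/-- **Pointwise bound on the remainder density.** With `φ = cutoff R`, `|Dφ| ≤ C₁/R`,
`|Δφ| ≤ C₂/R²` (and `Δφ = 0` off `B̄(0, 2R)`), `ω = curl v`, `N = √(|ω|² + ε²)`, `0 ≤ N − ε ≤ |ω|`,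
`|ω|² ≤ 2|∇v|²_F` and the stretching bound, for every `λ > 0`:
`|ν(Δφ)(N − ε) + (N − ε)(v·∇)φ + φ⟪ω, (ω·∇)v⟫/N|
   ≤ (νC₂λ/R² + C₁/R + 1)|∇v|²_F + (νC₂/(2λR²)) 1_{B̄(0,2R)} + (C₁/(2R))|v|²`
(Young: `|ω| ≤ λ|∇v|²_F + 1/(2λ)`, `|ω||v| ≤ |∇v|²_F + |v|²/2`). [folklore] -/
theorem abs_rest_le {ν : ℝ} (hν : 0 ≤ ν) {ε : ℝ} (hε : 0 ≤ ε) {R : ℝ} (hR : 0 < R) {C₁ C₂ : ℝ}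
    (hC₁' : ∀ x : (EuclideanSpace ℝ (Fin 3)), ‖fderiv ℝ (cutoff R) x‖ ≤ C₁ / R)
    (hC₂' : ∀ x : (EuclideanSpace ℝ (Fin 3)), |(Δ (cutoff R : (EuclideanSpace ℝ (Fin 3)) → ℝ)) x| ≤ C₂ / R ^ 2) {lam : ℝ} (hlam : 0 < lam)
    (v : (EuclideanSpace ℝ (Fin 3)) → (EuclideanSpace ℝ (Fin 3))) (x : (EuclideanSpace ℝ (Fin 3))) :
    |ν * ((Δ (cutoff R : (EuclideanSpace ℝ (Fin 3)) → ℝ)) x * (Real.sqrt (‖curl v x‖ ^ 2 + ε ^ 2) - ε))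
      + (Real.sqrt (‖curl v x‖ ^ 2 + ε ^ 2) - ε) * fderiv ℝ (cutoff R) x (v x)
      + cutoff R x * (⟪curl v x, fderiv ℝ v x (curl v x)⟫ / Real.sqrt (‖curl v x‖ ^ 2 + ε ^ 2))| ≤
      (ν * (C₂ / R ^ 2) * lam + C₁ / R + 1) * frobeniusNormSq (fderiv ℝ v x)
      + ν * (C₂ / R ^ 2) / (2 * lam) * (closedBall (0 : (EuclideanSpace ℝ (Fin 3))) (2 * R)).indicator (fun _ => (1 : ℝ)) x
      + C₁ / (2 * R) * ‖v x‖ ^ 2 := by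
  set ω := curl v x with hω
  set F := frobeniusNormSq (fderiv ℝ v x) with hF
  have hF0 : 0 ≤ F := frobeniusNormSq_nonneg _
  have hω2 : ‖ω‖ ^ 2 ≤ 2 * F := norm_curl_sq_le_two_mul_frobeniusNormSq v x
  have hNε0 : 0 ≤ Real.sqrt (‖ω‖ ^ 2 + ε ^ 2) - ε := regN_sub_nonneg hε _
  have hNε : Real.sqrt (‖ω‖ ^ 2 + ε ^ 2) - ε ≤ ‖ω‖ := regN_sub_le_norm hε _
  have hC₁0 : 0 ≤ C₁ / R := (norm_nonneg _).trans (hC₁' x)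
  have hC₂0 : 0 ≤ C₂ / R ^ 2 := (abs_nonneg _).trans (hC₂' x)
  have hyoung : ‖ω‖ ≤ lam * F + 1 / (2 * lam) := by
    have h1 := le_mul_sq_add_inv (t := ‖ω‖) hlam
    nlinarith
  -- term 1
  have ht1 : |ν * ((Δ (cutoff R : (EuclideanSpace ℝ (Fin 3)) → ℝ)) x * (Real.sqrt (‖ω‖ ^ 2 + ε ^ 2) - ε))| ≤
      ν * (C₂ / R ^ 2) * lam * F
      + ν * (C₂ / R ^ 2) / (2 * lam) * (closedBall (0 : (EuclideanSpace ℝ (Fin 3))) (2 * R)).indicator (fun _ => (1 : ℝ)) x := by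
    by_cases hx : x ∈ closedBall (0 : (EuclideanSpace ℝ (Fin 3))) (2 * R)
    · rw [indicator_of_mem hx, abs_mul, abs_of_nonneg hν, abs_mul, abs_of_nonneg hNε0]
      have h1 : |(Δ (cutoff R : (EuclideanSpace ℝ (Fin 3)) → ℝ)) x| * (Real.sqrt (‖ω‖ ^ 2 + ε ^ 2) - ε) ≤ C₂ / R ^ 2 * (lam * F + 1 / (2 * lam)) :=
        mul_le_mul (hC₂' x) (hNε.trans hyoung) hNε0 hC₂0
      have h2 := mul_le_mul_of_nonneg_left h1 hν
      have e : ν * (C₂ / R ^ 2 * (lam * F + 1 / (2 * lam))) =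
          ν * (C₂ / R ^ 2) * lam * F + ν * (C₂ / R ^ 2) / (2 * lam) * 1 := by ring
      linarith
    · have h0 : (Δ (cutoff R : (EuclideanSpace ℝ (Fin 3)) → ℝ)) x = 0 :=
        laplacian_eq_zero_of_notMem_tsupport fun h => hx (tsupport_cutoff_subset hR h)
      rw [h0, zero_mul, mul_zero, abs_zero, indicator_of_notMem hx, mul_zero, add_zero]
      positivity
  -- term 2
  have ht2 : |(Real.sqrt (‖ω‖ ^ 2 + ε ^ 2) - ε) * fderiv ℝ (cutoff R) x (v x)| ≤
      C₁ / R * F + C₁ / (2 * R) * ‖v x‖ ^ 2 := by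
    rw [abs_mul, abs_of_nonneg hNε0]
    have h1 : |fderiv ℝ (cutoff R) x (v x)| ≤ C₁ / R * ‖v x‖ :=
      (Real.norm_eq_abs _ ▸ (fderiv ℝ (cutoff R) x).le_opNorm (v x)).trans
        (mul_le_mul_of_nonneg_right (hC₁' x) (norm_nonneg _))
    have h2 : (Real.sqrt (‖ω‖ ^ 2 + ε ^ 2) - ε) * |fderiv ℝ (cutoff R) x (v x)| ≤ ‖ω‖ * (C₁ / R * ‖v x‖) :=
      mul_le_mul hNε h1 (abs_nonneg _) (norm_nonneg _)
    have h3 : ‖ω‖ * ‖v x‖ ≤ F + ‖v x‖ ^ 2 / 2 := by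
      nlinarith [sq_nonneg (‖ω‖ - ‖v x‖), norm_nonneg ω, norm_nonneg (v x)]
    calc (Real.sqrt (‖ω‖ ^ 2 + ε ^ 2) - ε) * |fderiv ℝ (cutoff R) x (v x)| ≤ C₁ / R * (‖ω‖ * ‖v x‖) := by
          linarith [h2]
      _ ≤ C₁ / R * (F + ‖v x‖ ^ 2 / 2) := mul_le_mul_of_nonneg_left h3 hC₁0
      _ = C₁ / R * F + C₁ / (2 * R) * ‖v x‖ ^ 2 := by ring
  -- term 3
  have ht3 : |cutoff R x * (⟪ω, fderiv ℝ v x ω⟫ / Real.sqrt (‖ω‖ ^ 2 + ε ^ 2))| ≤ F :=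
    (abs_mul_inner_stretch_div_regN_le v x (cutoff_nonneg R x) ε).trans
      (mul_le_of_le_one_left hF0 (cutoff_le_one R x))
  -- sum
  calc _ ≤ |ν * ((Δ (cutoff R : (EuclideanSpace ℝ (Fin 3)) → ℝ)) x * (Real.sqrt (‖ω‖ ^ 2 + ε ^ 2) - ε))|
        + |(Real.sqrt (‖ω‖ ^ 2 + ε ^ 2) - ε) * fderiv ℝ (cutoff R) x (v x)|
        + |cutoff R x * (⟪ω, fderiv ℝ v x ω⟫ / Real.sqrt (‖ω‖ ^ 2 + ε ^ 2))| := abs_add_three _ _ _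
    _ ≤ _ := by linarith [ht1, ht2, ht3]

/-- Measurability in time of the space `lintegral`s of a function continuous on the slab
(Tonelli). [folklore] -/
theorem aemeasurable_lintegral_ofReal_slab {g : ℝ × (EuclideanSpace ℝ (Fin 3)) → ℝ}
    (hg : ContinuousOn g (Icc 0 T' ×ˢ univ)) :
    AEMeasurable (fun τ => ∫⁻ x, ENNReal.ofReal (g (τ, x))) (volume.restrict (Ioo 0 T')) :=
  ((aestronglyMeasurable_prod_of_continuousOn hg).aemeasurable.ennreal_ofReal).lintegral_prod_right'

/-- **The remainder is small in `L¹((0,T') × ℝ³)`**: with the pointwise bound `abs_rest_le`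
integrated in space–time, for a classical solution on `[0, T'] × ℝ³` with
`∫₀^{T'}∫ |∇u|²_F ≤ D` and `∫₀^{T'}∫ |u|² ≤ C_E` (lower Lebesgue integrals),
`|∫₀^{T'}∫ rest| ≤ (νC₂λ/R² + C₁/R + 1) D + (νC₂/(2λR²)) T' |B̄(0,2R)| + (C₁/(2R)) C_E`. [folklore] -/
theorem IsClassicalNSSolutionOn.abs_integral_rest_le
    (hns : IsClassicalNSSolutionOn (Icc 0 T') ν 0 u p) (hT' : 0 < T') (hν : 0 ≤ ν)
    {ε : ℝ} (hε : 0 < ε) {R : ℝ} (hR : 0 < R) {C₁ C₂ : ℝ}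
    (hC₁' : ∀ x : (EuclideanSpace ℝ (Fin 3)), ‖fderiv ℝ (cutoff R) x‖ ≤ C₁ / R)
    (hC₂' : ∀ x : (EuclideanSpace ℝ (Fin 3)), |(Δ (cutoff R : (EuclideanSpace ℝ (Fin 3)) → ℝ)) x| ≤ C₂ / R ^ 2)
    {D : ℝ≥0∞} (hDfin : D ≠ ∞)
    (hD : ∫⁻ τ in Ioo 0 T', ∫⁻ x, ENNReal.ofReal (frobeniusNormSq (fderiv ℝ (u τ) x)) ≤ D)
    {CE : ℝ≥0∞} (hCEfin : CE ≠ ∞) (hCE : ∫⁻ τ in Ioo 0 T', ∫⁻ x, ‖u τ x‖ₑ ^ 2 ≤ CE)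
    {lam : ℝ} (hlam : 0 < lam) :
    |∫ τ in Ioo 0 T', ∫ x, (ν * ((Δ (cutoff R : (EuclideanSpace ℝ (Fin 3)) → ℝ)) x * (Real.sqrt (‖vorticity u τ x‖ ^ 2 + ε ^ 2) - ε))
        + (Real.sqrt (‖vorticity u τ x‖ ^ 2 + ε ^ 2) - ε) * fderiv ℝ (cutoff R) x (u τ x)
        + cutoff R x * (⟪vorticity u τ x, fderiv ℝ (u τ) x (vorticity u τ x)⟫ /
            Real.sqrt (‖vorticity u τ x‖ ^ 2 + ε ^ 2)))| ≤
      (ν * (C₂ / R ^ 2) * lam + C₁ / R + 1) * D.toReal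
      + ν * (C₂ / R ^ 2) / (2 * lam) * (T' * (volume (closedBall (0 : (EuclideanSpace ℝ (Fin 3))) (2 * R))).toReal)
      + C₁ / (2 * R) * CE.toReal := by
  have hU : UniqueDiffOn ℝ (Icc 0 T') := uniqueDiffOn_Icc hT'
  -- the three nonnegative constants
  set a₁ : ℝ := ν * (C₂ / R ^ 2) * lam + C₁ / R + 1 with ha₁
  set a₂ : ℝ := ν * (C₂ / R ^ 2) / (2 * lam) with ha₂
  set a₃ : ℝ := C₁ / (2 * R) with ha₃
  have hC₁0 : 0 ≤ C₁ / R := (norm_nonneg _).trans (hC₁' 0)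
  have hC₂0 : 0 ≤ C₂ / R ^ 2 := (abs_nonneg _).trans (hC₂' 0)
  have ha₁0 : 0 ≤ a₁ := by positivity
  have ha₂0 : 0 ≤ a₂ := by positivity
  have ha₃0 : 0 ≤ a₃ := by
    have : 0 ≤ C₁ := by
      have := mul_nonneg hC₁0 hR.le
      rwa [div_mul_cancel₀ _ hR.ne'] at this
    positivity
  set B := closedBall (0 : (EuclideanSpace ℝ (Fin 3))) (2 * R) with hB
  have hVfin : volume B ≠ ∞ := measure_closedBall_lt_top.ne
  -- the dominating function
  set A : ℝ → ℝ≥0∞ := fun τ => ∫⁻ x, ENNReal.ofReal (frobeniusNormSq (fderiv ℝ (u τ) x)) with hA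
  set E : ℝ → ℝ≥0∞ := fun τ => ∫⁻ x, ENNReal.ofReal (‖u τ x‖ ^ 2) with hE
  set G : ℝ × (EuclideanSpace ℝ (Fin 3)) → ℝ≥0∞ := fun z => ENNReal.ofReal (a₁ * frobeniusNormSq (fderiv ℝ (u z.1) z.2))
    + ENNReal.ofReal (a₂ * B.indicator (fun _ => (1 : ℝ)) z.2)
    + ENNReal.ofReal (a₃ * ‖u z.1 z.2‖ ^ 2) with hG
  set Rr : ℝ × (EuclideanSpace ℝ (Fin 3)) → ℝ := fun z => ν * ((Δ (cutoff R : (EuclideanSpace ℝ (Fin 3)) → ℝ)) z.2 * (Real.sqrt (‖vorticity u z.1 z.2‖ ^ 2 + ε ^ 2) - ε))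
      + (Real.sqrt (‖vorticity u z.1 z.2‖ ^ 2 + ε ^ 2) - ε) * fderiv ℝ (cutoff R) z.2 (u z.1 z.2)
      + cutoff R z.2 * (⟪vorticity u z.1 z.2, fderiv ℝ (u z.1) z.2 (vorticity u z.1 z.2)⟫ /
          Real.sqrt (‖vorticity u z.1 z.2‖ ^ 2 + ε ^ 2)) with hRr
  have hind0 : ∀ y : (EuclideanSpace ℝ (Fin 3)), 0 ≤ B.indicator (fun _ => (1 : ℝ)) y :=
    fun y => indicator_nonneg (fun _ _ => zero_le_one) y
  have hpt : ∀ z : ℝ × (EuclideanSpace ℝ (Fin 3)), ‖Rr z‖ₑ ≤ G z := by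
    intro z
    rw [Real.enorm_eq_ofReal_abs]
    have h : |Rr z| ≤ a₁ * frobeniusNormSq (fderiv ℝ (u z.1) z.2)
        + a₂ * B.indicator (fun _ => (1 : ℝ)) z.2 + a₃ * ‖u z.1 z.2‖ ^ 2 :=
      abs_rest_le hν hε.le hR hC₁' hC₂' hlam (u z.1) z.2
    have hX : 0 ≤ a₁ * frobeniusNormSq (fderiv ℝ (u z.1) z.2) :=
      mul_nonneg ha₁0 (frobeniusNormSq_nonneg _)
    have hY : 0 ≤ a₂ * B.indicator (fun _ => (1 : ℝ)) z.2 := mul_nonneg ha₂0 (hind0 _)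
    have hZ : 0 ≤ a₃ * ‖u z.1 z.2‖ ^ 2 := mul_nonneg ha₃0 (sq_nonneg _)
    refine (ENNReal.ofReal_le_ofReal h).trans (le_of_eq ?_)
    rw [ENNReal.ofReal_add (add_nonneg hX hY) hZ, ENNReal.ofReal_add hX hY]
  -- slice-wise splitting of the space integral (for `τ` in the slab, where `u τ` is smooth)
  have hslice : ∀ τ ∈ Ioo 0 T', ∫⁻ x, G (τ, x) =
      ENNReal.ofReal a₁ * A τ + ENNReal.ofReal a₂ * volume B + ENNReal.ofReal a₃ * E τ := by
    intro τ hτ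
    have hτ' : τ ∈ Icc 0 T' := Ioo_subset_Icc_self hτ
    have hu1 : ContDiff ℝ 1 (u τ) := (hns.contDiff_velocity hτ').of_le (by exact_mod_cast le_top)
    have hm₂ : Measurable fun x : (EuclideanSpace ℝ (Fin 3)) => ENNReal.ofReal (a₂ * B.indicator (fun _ => (1 : ℝ)) x) :=
      ENNReal.measurable_ofReal.comp (measurable_const.mul
        ((measurable_const.indicator measurableSet_closedBall)))
    have hm₃ : Measurable fun x : (EuclideanSpace ℝ (Fin 3)) => ENNReal.ofReal (a₃ * ‖u τ x‖ ^ 2) :=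
      ENNReal.measurable_ofReal.comp (measurable_const.mul (hu1.continuous.norm.pow 2).measurable)
    have e1 : ∫⁻ x, ENNReal.ofReal (a₁ * frobeniusNormSq (fderiv ℝ (u τ) x)) =
        ENNReal.ofReal a₁ * A τ := by
      rw [hA, ← lintegral_const_mul' _ _ ENNReal.ofReal_ne_top]
      exact lintegral_congr fun x => by rw [ENNReal.ofReal_mul ha₁0]
    have e2 : ∫⁻ x, ENNReal.ofReal (a₂ * B.indicator (fun _ => (1 : ℝ)) x) =
        ENNReal.ofReal a₂ * volume B := by
      rw [← lintegral_indicator_const measurableSet_closedBall]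
      refine lintegral_congr fun x => ?_
      by_cases hx : x ∈ B
      · rw [indicator_of_mem hx, indicator_of_mem hx, mul_one]
      · rw [indicator_of_notMem hx, indicator_of_notMem hx, mul_zero, ENNReal.ofReal_zero]
    have e3 : ∫⁻ x, ENNReal.ofReal (a₃ * ‖u τ x‖ ^ 2) = ENNReal.ofReal a₃ * E τ := by
      rw [hE, ← lintegral_const_mul' _ _ ENNReal.ofReal_ne_top]
      exact lintegral_congr fun x => by rw [ENNReal.ofReal_mul ha₃0]
    show ∫⁻ x, (ENNReal.ofReal (a₁ * frobeniusNormSq (fderiv ℝ (u τ) x))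
      + ENNReal.ofReal (a₂ * B.indicator (fun _ => (1 : ℝ)) x)
      + ENNReal.ofReal (a₃ * ‖u τ x‖ ^ 2)) = _
    rw [lintegral_add_right _ hm₃, lintegral_add_right _ hm₂, e1, e2, e3]
  -- measurability in time of the two variable pieces
  have hDu_c : ContinuousOn (fun z : ℝ × (EuclideanSpace ℝ (Fin 3)) => frobeniusNormSq (fderiv ℝ (u z.1) z.2))
      (Icc 0 T' ×ˢ univ) := by
    have h := (hns.smooth_velocity.fderiv_slice hU).continuousOn
    unfold frobeniusNormSq
    exact continuousOn_finsetSum _ fun i _ => ((h.clm_apply continuousOn_const).norm).pow 2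
  have hu_c : ContinuousOn (fun z : ℝ × (EuclideanSpace ℝ (Fin 3)) => ‖u z.1 z.2‖ ^ 2) (Icc 0 T' ×ˢ univ) :=
    (hns.smooth_velocity.continuousOn.norm).pow 2
  have hmA : AEMeasurable A (volume.restrict (Ioo 0 T')) := aemeasurable_lintegral_ofReal_slab hDu_c
  have hmE : AEMeasurable E (volume.restrict (Ioo 0 T')) := aemeasurable_lintegral_ofReal_slab hu_c
  -- the space–time bound
  have hE' : ∫⁻ τ in Ioo 0 T', E τ ≤ CE := by
    refine le_trans (le_of_eq (lintegral_congr fun τ => lintegral_congr fun x => ?_)) hCE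
    rw [← ofReal_norm, ENNReal.ofReal_pow (norm_nonneg _)]
  have hbound : ∫⁻ τ in Ioo 0 T', ∫⁻ x, G (τ, x) ≤
      ENNReal.ofReal a₁ * D + ENNReal.ofReal a₂ * volume B * ENNReal.ofReal T'
        + ENNReal.ofReal a₃ * CE := by
    calc ∫⁻ τ in Ioo 0 T', ∫⁻ x, G (τ, x)
        = ∫⁻ τ in Ioo 0 T', (ENNReal.ofReal a₁ * A τ + ENNReal.ofReal a₂ * volume B
            + ENNReal.ofReal a₃ * E τ) := setLIntegral_congr_fun measurableSet_Ioo hslice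
      _ = ENNReal.ofReal a₁ * (∫⁻ τ in Ioo 0 T', A τ)
          + ENNReal.ofReal a₂ * volume B * volume (Ioo (0 : ℝ) T')
          + ENNReal.ofReal a₃ * (∫⁻ τ in Ioo 0 T', E τ) := by
          rw [lintegral_add_right' _ (hmE.const_mul _), lintegral_add_left' (hmA.const_mul _),
            lintegral_const_mul'' _ hmA, lintegral_const_mul'' _ hmE, setLIntegral_const]
      _ ≤ _ := by
          rw [Real.volume_Ioo, sub_zero]
          gcongr
  have hfin : ENNReal.ofReal a₁ * D + ENNReal.ofReal a₂ * volume B * ENNReal.ofReal T'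
      + ENNReal.ofReal a₃ * CE ≠ ∞ := by
    refine ENNReal.add_ne_top.2 ⟨ENNReal.add_ne_top.2 ⟨ENNReal.mul_ne_top ENNReal.ofReal_ne_top hDfin,
      ENNReal.mul_ne_top (ENNReal.mul_ne_top ENNReal.ofReal_ne_top hVfin) ENNReal.ofReal_ne_top⟩,
      ENNReal.mul_ne_top ENNReal.ofReal_ne_top hCEfin⟩
  have hle : ∫⁻ τ in Ioo 0 T', ∫⁻ x, ‖Rr (τ, x)‖ₑ ≤
      ENNReal.ofReal a₁ * D + ENNReal.ofReal a₂ * volume B * ENNReal.ofReal T'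
        + ENNReal.ofReal a₃ * CE :=
    (lintegral_mono fun τ => lintegral_mono fun x => hpt (τ, x)).trans hbound
  have hmain : ‖∫ τ in Ioo 0 T', ∫ x, Rr (τ, x)‖ ≤
      (ENNReal.ofReal a₁ * D + ENNReal.ofReal a₂ * volume B * ENNReal.ofReal T'
        + ENNReal.ofReal a₃ * CE).toReal :=
    norm_integral_integral_le_of_lintegral_le hfin hle
  rw [Real.norm_eq_abs] at hmain
  refine hmain.trans (le_of_eq ?_)
  rw [ENNReal.toReal_add (ENNReal.add_ne_top.2 ⟨ENNReal.mul_ne_top ENNReal.ofReal_ne_top hDfin,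
      ENNReal.mul_ne_top (ENNReal.mul_ne_top ENNReal.ofReal_ne_top hVfin) ENNReal.ofReal_ne_top⟩)
      (ENNReal.mul_ne_top ENNReal.ofReal_ne_top hCEfin),
    ENNReal.toReal_add (ENNReal.mul_ne_top ENNReal.ofReal_ne_top hDfin)
      (ENNReal.mul_ne_top (ENNReal.mul_ne_top ENNReal.ofReal_ne_top hVfin) ENNReal.ofReal_ne_top),
    ENNReal.toReal_mul, ENNReal.toReal_mul, ENNReal.toReal_mul, ENNReal.toReal_mul,
    ENNReal.toReal_ofReal ha₁0, ENNReal.toReal_ofReal ha₂0, ENNReal.toReal_ofReal ha₃0,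
    ENNReal.toReal_ofReal hT'.le]
  ring

end Assembly

/-! ### Data from the Leray–Hopf hypothesis and from the decay of the datum -/

section Data

variable {ν T : ℝ} {u : ℝ → (EuclideanSpace ℝ (Fin 3)) → (EuclideanSpace ℝ (Fin 3))} {p : ℝ → (EuclideanSpace ℝ (Fin 3)) → ℝ}

/-- **Dissipation of a classical Leray–Hopf solution through the classical gradient**: the weak
gradient `G` of the Leray–Hopf energy inequality agrees a.e. with `∇u(t)` for a.e. `t`
(uniqueness of weak gradients, `HasWeakFDerivOn.unique_holds`), so `∫₀ᵀ∫ |∇u|²_F < ∞` and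
`ν ∫₀ᵀ∫ |∇u|²_F ≤ ½‖u(0)‖₂²` (the energy inequality from `s = 0` with `f = 0`; Constantin 1990,
(2.21)). [cite: Constantin1990, §2 eq. (2.21)] -/
theorem IsLerayHopfOn.lintegral_frobeniusNormSq_fderiv_of_classical
    (hns : IsClassicalNSSolutionOn (Ico 0 T) ν 0 u p) (hlh : IsLerayHopfOn T ν 0 (u 0) u)
    (hT : 0 < T) :
    (∫⁻ τ in Ioo 0 T, ∫⁻ x, ENNReal.ofReal (frobeniusNormSq (fderiv ℝ (u τ) x))) ≠ ∞ ∧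
    ν * (∫⁻ τ in Ioo 0 T, ∫⁻ x, ENNReal.ofReal (frobeniusNormSq (fderiv ℝ (u τ) x))).toReal ≤
      VectorCalculus.kineticEnergy (u 0) := by
  obtain ⟨G, hG, hGfin, hE0, -⟩ := hlh.weakGrad_energy
  have hae : ∀ᵐ τ ∂(volume.restrict (Ioo 0 T)), ∫⁻ x, ENNReal.ofReal (frobeniusNormSq (G τ x)) =
      ∫⁻ x, ENNReal.ofReal (frobeniusNormSq (fderiv ℝ (u τ) x)) := by
    filter_upwards [hG, ae_restrict_mem measurableSet_Ioo] with τ hGτ hτ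
    have hu1 : ContDiff ℝ 1 (u τ) :=
      (hns.contDiff_velocity (Ioo_subset_Ico_self hτ)).of_le (by exact_mod_cast le_top)
    have heq : G τ =ᵐ[volume] fderiv ℝ (u τ) := by
      have := FunctionSpaces.HasWeakFDerivOn.unique_holds hGτ (hasWeakGradient_fderiv_of_contDiff hu1)
      simpa [Measure.restrict_univ] using this
    refine lintegral_congr_ae ?_
    filter_upwards [heq] with x hx
    rw [hx]
  have hEq : ∫⁻ τ in Ioo 0 T, ∫⁻ x, ENNReal.ofReal (frobeniusNormSq (G τ x)) =
      ∫⁻ τ in Ioo 0 T, ∫⁻ x, ENNReal.ofReal (frobeniusNormSq (fderiv ℝ (u τ) x)) :=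
    lintegral_congr_ae hae
  refine ⟨?_, ?_⟩
  · rw [← hEq]
    exact hGfin.ne
  · have h := hE0 T ⟨hT.le, le_rfl⟩
    simp only [Pi.zero_apply, inner_zero_left, integral_zero, intervalIntegral.integral_zero,
      add_zero] at h
    rw [← hEq]
    linarith [kineticEnergy_nonneg (u T)]

/-- `u ∈ L^∞(0,T; L²)` gives `∫₀ᵀ∫ |u|² < ∞` (as a lower Lebesgue integral). [folklore] -/
theorem IsLerayHopfOn.exists_lintegral_enorm_sq_le (hlh : IsLerayHopfOn T ν 0 (u 0) u) :
    ∃ C : ℝ≥0∞, C ≠ ∞ ∧ ∫⁻ τ in Ioo 0 T, ∫⁻ x, ‖u τ x‖ₑ ^ 2 ≤ C := by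
  obtain ⟨C, hC⟩ := hlh.energy_bound
  refine ⟨C * volume (Ioo (0 : ℝ) T), ENNReal.mul_ne_top ENNReal.coe_ne_top
    (by rw [Real.volume_Ioo]; exact ENNReal.ofReal_ne_top), ?_⟩
  calc ∫⁻ τ in Ioo 0 T, ∫⁻ x, ‖u τ x‖ₑ ^ 2 ≤ ∫⁻ _ in Ioo (0 : ℝ) T, (C : ℝ≥0∞) :=
        lintegral_mono_ae hC
    _ = C * volume (Ioo (0 : ℝ) T) := setLIntegral_const _ _

/-- The vorticity of a rapidly decaying `C¹` datum is integrable: `|curl v| ≤ κ |∇v| ≤ κ C (1+|x|)⁻⁴`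
with `(1+|x|)⁻⁴ ∈ L¹(ℝ³)` (Mathlib `integrable_one_add_norm`). [folklore] -/
theorem integrable_norm_curl_of_hasRapidSpatialDecay {v : (EuclideanSpace ℝ (Fin 3)) → (EuclideanSpace ℝ (Fin 3))} (hv : ContDiff ℝ 1 v)
    (hdec : HasRapidSpatialDecay v) : Integrable fun x => ‖curl v x‖ := by
  obtain ⟨C, hC⟩ := hdec 1 4
  have hrank : (Module.finrank ℝ (EuclideanSpace ℝ (Fin 3)) : ℝ) < 4 := by
    rw [finrank_euclideanSpace, Fintype.card_fin]
    norm_num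
  have hint : Integrable (fun x : (EuclideanSpace ℝ (Fin 3)) => (1 + ‖x‖) ^ (-(4 : ℝ))) volume :=
    integrable_one_add_norm hrank
  refine (hint.const_mul (‖curlCLM‖ * C)).mono' (continuous_curl hv).norm.aestronglyMeasurable
    (Eventually.of_forall fun x => ?_)
  rw [Real.norm_eq_abs, abs_of_nonneg (norm_nonneg _)]
  have h1 := norm_curl_le v x
  have h2 := hC x
  rw [norm_iteratedFDeriv_one] at h2
  have hpos : 0 < (1 + ‖x‖) ^ 4 := by positivity
  have h3 : ‖fderiv ℝ v x‖ ≤ C * (1 + ‖x‖) ^ (-(4 : ℝ)) := by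
    rw [Real.rpow_neg (by positivity), show (4 : ℝ) = ((4 : ℕ) : ℝ) by norm_num, Real.rpow_natCast,
      ← div_eq_mul_inv, le_div_iff₀ hpos]
    linarith
  calc ‖curl v x‖ ≤ ‖curlCLM‖ * ‖fderiv ℝ v x‖ := h1
    _ ≤ ‖curlCLM‖ * (C * (1 + ‖x‖) ^ (-(4 : ℝ))) := by gcongr
    _ = ‖curlCLM‖ * C * (1 + ‖x‖) ^ (-(4 : ℝ)) := by ring

end Data

/-! ### From the real slab bound to the extended space–time integral -/

section Final

variable {ν T : ℝ} {u : ℝ → (EuclideanSpace ℝ (Fin 3)) → (EuclideanSpace ℝ (Fin 3))} {p : ℝ → (EuclideanSpace ℝ (Fin 3)) → ℝ}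

/-- The extended space–time integral of the cut-off lower density over `(0, T') × ℝ³` is the
`ofReal` of the iterated real integral (Tonelli for the nonnegative continuous integrand with
compact `x`-support). [folklore] -/
theorem IsClassicalNSSolutionOn.lintegral_prod_cutoff_dirDissLow_eq {T' : ℝ}
    (hns : IsClassicalNSSolutionOn (Icc 0 T') ν 0 u p) (hT' : 0 < T') {ε : ℝ} (hε : ε ≠ 0)
    {R : ℝ} (hR : 0 < R) :
    ∫⁻ q in Ioo 0 T' ×ˢ (univ : Set (EuclideanSpace ℝ (Fin 3))), ENNReal.ofReal (cutoff R q.2 * ((∑ i, (‖fderiv ℝ (vorticity u q.1) q.2 ((stdOrthonormalBasis ℝ (EuclideanSpace ℝ (Fin 3))) i)‖ ^ 2 * ‖(vorticity u q.1) q.2‖ ^ 2 - ⟪(vorticity u q.1) q.2, fderiv ℝ (vorticity u q.1) q.2 ((stdOrthonormalBasis ℝ (EuclideanSpace ℝ (Fin 3))) i)⟫ ^ 2)) / Real.sqrt (‖(vorticity u q.1) q.2‖ ^ 2 + ε ^ 2) ^ 3)) =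
      ENNReal.ofReal (∫ τ in Ioo 0 T', ∫ x, cutoff R x * ((∑ i, (‖fderiv ℝ (vorticity u τ) x ((stdOrthonormalBasis ℝ (EuclideanSpace ℝ (Fin 3))) i)‖ ^ 2 * ‖(vorticity u τ) x‖ ^ 2 - ⟪(vorticity u τ) x, fderiv ℝ (vorticity u τ) x ((stdOrthonormalBasis ℝ (EuclideanSpace ℝ (Fin 3))) i)⟫ ^ 2)) / Real.sqrt (‖(vorticity u τ) x‖ ^ 2 + ε ^ 2) ^ 3)) := by
  have hU : UniqueDiffOn ℝ (Icc 0 T') := uniqueDiffOn_Icc hT'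
  have hw : IsSmoothSpaceTimeOn (Icc 0 T') (vorticity u) := hns.isSmoothSpaceTimeOn_vorticity hU
  set H : ℝ × (EuclideanSpace ℝ (Fin 3)) → ℝ := fun z => cutoff R z.2 * ((∑ i, (‖fderiv ℝ (vorticity u z.1) z.2 ((stdOrthonormalBasis ℝ (EuclideanSpace ℝ (Fin 3))) i)‖ ^ 2 * ‖(vorticity u z.1) z.2‖ ^ 2 - ⟪(vorticity u z.1) z.2, fderiv ℝ (vorticity u z.1) z.2 ((stdOrthonormalBasis ℝ (EuclideanSpace ℝ (Fin 3))) i)⟫ ^ 2)) / Real.sqrt (‖(vorticity u z.1) z.2‖ ^ 2 + ε ^ 2) ^ 3) with hH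
  have hHc : ContinuousOn H (Icc 0 T' ×ˢ univ) :=
    ((contDiff_cutoff (n := 0) R).continuous.comp continuous_snd).continuousOn.mul
      (continuousOn_dirDissLow_slab hw hU hε)
  have hHK : ∀ τ ∈ Icc 0 T', ∀ x ∉ tsupport (cutoff (E := (EuclideanSpace ℝ (Fin 3))) R), H (τ, x) = 0 := fun τ _ x hx => by
    simp only [hH, image_eq_zero_of_notMem_tsupport hx, zero_mul]
  have hint := integrable_prod_of_continuousOn (hasCompactSupport_cutoff hR) hHc hHK
  have hH0 : ∀ z, 0 ≤ H z := fun z => mul_nonneg (cutoff_nonneg R _) (dirDissLow_nonneg _ _ _)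
  have hμ : (volume : Measure (ℝ × (EuclideanSpace ℝ (Fin 3)))).restrict (Ioo 0 T' ×ˢ univ) =
      ((volume : Measure ℝ).restrict (Ioo 0 T')).prod (volume : Measure (EuclideanSpace ℝ (Fin 3))) := by
    rw [Measure.volume_eq_prod, Measure.restrict_prod_eq_prod_univ]
  rw [hμ, ← integral_prod _ hint, ofReal_integral_eq_lintegral_ofReal hint
    (Eventually.of_forall hH0)]

/-- Exhaustion of `(0, T) × ℝ³` by the slabs `(0, T − T/(m+2)) × B(0, m+1)`. [folklore] -/
theorem iUnion_Ioo_prod_ball (hT : 0 < T) :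
    (⋃ m : ℕ, Ioo (0 : ℝ) (T - T / ((m : ℝ) + 2)) ×ˢ ball (0 : (EuclideanSpace ℝ (Fin 3))) ((m : ℝ) + 1)) =
      Ioo 0 T ×ˢ univ := by
  have hmono₁ : Monotone fun m : ℕ => Ioo (0 : ℝ) (T - T / ((m : ℝ) + 2)) := by
    intro a b hab
    refine Ioo_subset_Ioo le_rfl ?_
    gcongr
  have hmono₂ : Monotone fun m : ℕ => ball (0 : (EuclideanSpace ℝ (Fin 3))) ((m : ℝ) + 1) := by
    intro a b hab
    exact ball_subset_ball (by exact_mod_cast Nat.succ_le_succ hab)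
  rw [iUnion_prod_of_monotone hmono₁ hmono₂, iUnion_ball_nat_succ]
  congr 1
  ext t
  simp only [mem_iUnion, mem_Ioo]
  constructor
  · rintro ⟨m, h0, ht⟩
    exact ⟨h0, ht.trans (sub_lt_self T (by positivity))⟩
  · rintro ⟨h0, htT⟩
    obtain ⟨m, hm⟩ := exists_nat_gt (T / (T - t))
    refine ⟨m, h0, ?_⟩
    have hTt : 0 < T - t := sub_pos.2 htT
    have hpos : 0 < T / (T - t) := div_pos hT hTt
    have h1 : T / ((m : ℝ) + 2) < T / (T / (T - t)) :=
      div_lt_div_of_pos_left hT hpos (by linarith)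
    rw [div_div_cancel₀ hT.ne'] at h1
    linarith

/-- **Discharge of `constantin1990_direction_dissipation_bound`** (Constantin 1990, the argument
of §2: (2.5)–(2.9) with `q(y) = √(1 + |y|²)`, i.e. the regularised modulus `√(|ω|² + ε²)`,
integrated against a cut-off, the stretching term bounded by the dissipation and the energy
inequality (2.21)). For `ε > 0`, `0 < T' < T` and `R > 0` the slab inequality and the remainder
bound give the real estimate
`ν ∫₀^{T'}∫ φ_R Dlow_ε ≤ ‖ω₀‖₁ + ∫₀ᵀ∫|∇u|² + err(R)` with `err → 0` (`R = k²`, `λ = k³`);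
exhausting `(0,T) × ℝ³` by `(0, T − T/(m+2)) × B(0, m+1)` (where `φ_R = 1`) and letting
`k → ∞` bounds `ν ∫∫ Dlow_ε` by `‖ω₀‖₁ + ∫₀ᵀ∫|∇u|²`; monotone convergence `Dlow_{1/(n+1)} ↑ Dlow₀ =
|ω||∇ξ|²` and `ν∫₀ᵀ∫|∇u|² ≤ ½‖u₀‖₂²` conclude. [cite: Constantin1990, §2 eqs. (2.5)–(2.9), (2.16), (2.21)] -/
theorem constantin1990_direction_dissipation_bound_holds :
    constantin1990_direction_dissipation_bound := by
  intro ν T hν hT u p hns hlh hdec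
  -- data
  have h0T : (0 : ℝ) ∈ Ico 0 T := ⟨le_rfl, hT⟩
  have hu0 : ContDiff ℝ 1 (u 0) := (hns.contDiff_velocity h0T).of_le (by exact_mod_cast le_top)
  have hω₀ : Integrable fun x => ‖curl (u 0) x‖ := integrable_norm_curl_of_hasRapidSpatialDecay hu0 hdec
  obtain ⟨hDfin, hDE⟩ := IsLerayHopfOn.lintegral_frobeniusNormSq_fderiv_of_classical hns hlh hT
  set D := ∫⁻ τ in Ioo 0 T, ∫⁻ x, ENNReal.ofReal (frobeniusNormSq (fderiv ℝ (u τ) x)) with hDdef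
  obtain ⟨CE, hCEfin, hCE⟩ := IsLerayHopfOn.exists_lintegral_enorm_sq_le hlh
  obtain ⟨C₁, hC₁0, hC₁⟩ := exists_norm_fderiv_cutoff_le (E := (EuclideanSpace ℝ (Fin 3)))
  obtain ⟨C₂, hC₂0, hC₂⟩ := exists_abs_laplacian_cutoff_le (E := (EuclideanSpace ℝ (Fin 3)))
  set V₁ : ℝ := (volume (ball (0 : (EuclideanSpace ℝ (Fin 3))) 1)).toReal with hV₁
  set Kω : ℝ := ∫ x, ‖curl (u 0) x‖ with hKω
  have hKω0 : 0 ≤ Kω := integral_nonneg fun x => norm_nonneg _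
  have hDr0 : 0 ≤ D.toReal := ENNReal.toReal_nonneg
  have hCEr0 : 0 ≤ CE.toReal := ENNReal.toReal_nonneg
  have hV₁0 : 0 ≤ V₁ := ENNReal.toReal_nonneg
  -- the error function
  set err : ℕ → ℝ := fun k => (ν * C₂ / k + C₁ / k ^ 2) * D.toReal + 4 * ν * C₂ * T * V₁ / k
    + C₁ / (2 * k ^ 2) * CE.toReal with herr
  have herr_tendsto : Tendsto err atTop (𝓝 0) := by
    have h1 : Tendsto (fun k : ℕ => (k : ℝ)⁻¹) atTop (𝓝 0) := tendsto_inv_atTop_nhds_zero_nat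
    have h2 : Tendsto (fun k : ℕ => ((k : ℝ) ^ 2)⁻¹) atTop (𝓝 0) := by
      simpa using h1.pow 2
    have : Tendsto (fun k : ℕ => (ν * C₂ * (k : ℝ)⁻¹ + C₁ * ((k : ℝ) ^ 2)⁻¹) * D.toReal
        + 4 * ν * C₂ * T * V₁ * (k : ℝ)⁻¹ + C₁ / 2 * ((k : ℝ) ^ 2)⁻¹ * CE.toReal) atTop (𝓝 0) := by
      have := ((((h1.const_mul (ν * C₂)).add (h2.const_mul C₁)).mul_const D.toReal).add
        (h1.const_mul (4 * ν * C₂ * T * V₁))).add ((h2.const_mul (C₁ / 2)).mul_const CE.toReal)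
      simpa using this
    refine this.congr fun k => ?_
    simp only [herr]
    ring
  -- the real slab bound, for `ε > 0`, `0 < T' < T`, `k ≥ 1`, `R = k²`
  have hreal : ∀ {ε : ℝ}, 0 < ε → ∀ {T' : ℝ}, 0 < T' → T' < T → ∀ k : ℕ, 1 ≤ k →
      ν * ∫ τ in Ioo 0 T', ∫ x, cutoff ((k : ℝ) ^ 2) x * ((∑ i, (‖fderiv ℝ (vorticity u τ) x ((stdOrthonormalBasis ℝ (EuclideanSpace ℝ (Fin 3))) i)‖ ^ 2 * ‖(vorticity u τ) x‖ ^ 2 - ⟪(vorticity u τ) x, fderiv ℝ (vorticity u τ) x ((stdOrthonormalBasis ℝ (EuclideanSpace ℝ (Fin 3))) i)⟫ ^ 2)) / Real.sqrt (‖(vorticity u τ) x‖ ^ 2 + ε ^ 2) ^ 3) ≤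
        Kω + D.toReal + err k := by
    intro ε hε T' hT'0 hT'T k hk
    have hk0 : (0 : ℝ) < k := by exact_mod_cast hk
    set R : ℝ := (k : ℝ) ^ 2 with hRdef
    have hR : 0 < R := by positivity
    have hns' : IsClassicalNSSolutionOn (Icc 0 T') ν 0 u p :=
      hns.mono (Icc_subset_Ico_right hT'T) (uniqueDiffOn_Icc hT'0)
    have hslab := hns'.direction_dissipation_slab_le hT'0 hν.le (contDiff_cutoff R)
      (hasCompactSupport_cutoff hR) (cutoff_nonneg R) hε
    -- the datum term
    have hdat : ∫ x, cutoff R x * ‖vorticity u 0 x‖ ≤ Kω := by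
      refine integral_mono ?_ hω₀ fun x => ?_
      · exact ((contDiff_cutoff (n := 0) R).continuous.mul (continuous_curl hu0).norm)
          |>.integrable_of_hasCompactSupport (hasCompactSupport_cutoff hR).mul_right
      · exact mul_le_of_le_one_left (norm_nonneg _) (cutoff_le_one R x)
    -- the remainder term
    have hD' : ∫⁻ τ in Ioo 0 T', ∫⁻ x, ENNReal.ofReal (frobeniusNormSq (fderiv ℝ (u τ) x)) ≤ D :=
      lintegral_Ioo_mono le_rfl hT'T.le
    have hCE' : ∫⁻ τ in Ioo 0 T', ∫⁻ x, ‖u τ x‖ₑ ^ 2 ≤ CE :=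
      (lintegral_Ioo_mono le_rfl hT'T.le).trans hCE
    have hrest := hns'.abs_integral_rest_le hT'0 hν.le hε hR (hC₁ R hR) (hC₂ R hR) hDfin hD' hCEfin
      hCE' (lam := (k : ℝ) ^ 3) (by positivity)
    -- the volume of the ball of radius `2R`
    have hvol : (volume (closedBall (0 : (EuclideanSpace ℝ (Fin 3))) (2 * R))).toReal = (2 * R) ^ 3 * V₁ := by
      rw [Measure.addHaar_closedBall _ _ (by positivity : (0 : ℝ) ≤ 2 * R), ENNReal.toReal_mul,
        ENNReal.toReal_ofReal (by positivity), finrank_euclideanSpace, Fintype.card_fin]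
    rw [hvol] at hrest
    -- algebra
    have hcoef₁ : (ν * (C₂ / R ^ 2) * (k : ℝ) ^ 3 + C₁ / R + 1) * D.toReal =
        D.toReal + (ν * C₂ / k + C₁ / k ^ 2) * D.toReal := by
      rw [hRdef]
      field_simp
      ring
    have hcoef₂ : ν * (C₂ / R ^ 2) / (2 * (k : ℝ) ^ 3) * (T' * ((2 * R) ^ 3 * V₁)) =
        4 * ν * C₂ * T' * V₁ / k := by
      rw [hRdef]
      field_simp
      ring
    have hcoef₃ : C₁ / (2 * R) * CE.toReal = C₁ / (2 * k ^ 2) * CE.toReal := by rw [hRdef]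
    have hT'le : 4 * ν * C₂ * T' * V₁ / k ≤ 4 * ν * C₂ * T * V₁ / k := by
      gcongr
    rw [hcoef₁, hcoef₂, hcoef₃] at hrest
    have : Kω + D.toReal + err k = Kω + (D.toReal + (ν * C₂ / k + C₁ / k ^ 2) * D.toReal
        + 4 * ν * C₂ * T * V₁ / k + C₁ / (2 * k ^ 2) * CE.toReal) := by
      simp only [herr]
      ring
    rw [this]
    linarith
  -- the extended bound on the slabs `Q m`, for `ε > 0`
  have hQ : ∀ {ε : ℝ}, 0 < ε → ∀ m : ℕ,
      ENNReal.ofReal ν * ∫⁻ q in Ioo (0 : ℝ) (T - T / ((m : ℝ) + 2)) ×ˢ ball (0 : (EuclideanSpace ℝ (Fin 3))) ((m : ℝ) + 1),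
        ENNReal.ofReal (((∑ i, (‖fderiv ℝ (vorticity u q.1) q.2 ((stdOrthonormalBasis ℝ (EuclideanSpace ℝ (Fin 3))) i)‖ ^ 2 * ‖(vorticity u q.1) q.2‖ ^ 2 - ⟪(vorticity u q.1) q.2, fderiv ℝ (vorticity u q.1) q.2 ((stdOrthonormalBasis ℝ (EuclideanSpace ℝ (Fin 3))) i)⟫ ^ 2)) / Real.sqrt (‖(vorticity u q.1) q.2‖ ^ 2 + ε ^ 2) ^ 3)) ≤ ENNReal.ofReal (Kω + D.toReal) := by
    intro ε hε m
    set T' : ℝ := T - T / ((m : ℝ) + 2) with hT'def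
    have hT'T : T' < T := sub_lt_self T (by positivity)
    have hT'0 : 0 < T' := by
      rw [hT'def, sub_pos, div_lt_iff₀ (by positivity)]
      nlinarith
    have hns' : IsClassicalNSSolutionOn (Icc 0 T') ν 0 u p :=
      hns.mono (Icc_subset_Ico_right hT'T) (uniqueDiffOn_Icc hT'0)
    have hlim : Tendsto (fun k : ℕ => ENNReal.ofReal (Kω + D.toReal + err k)) atTop
        (𝓝 (ENNReal.ofReal (Kω + D.toReal))) := by
      refine (ENNReal.continuous_ofReal.tendsto _).comp ?_
      simpa using (tendsto_const_nhds (x := Kω + D.toReal)).add herr_tendsto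
    refine ge_of_tendsto hlim ?_
    filter_upwards [eventually_ge_atTop (m + 1)] with k hk
    have hk1 : 1 ≤ k := le_trans (Nat.le_add_left 1 m) hk
    have hk0 : (0 : ℝ) < k := by exact_mod_cast hk1
    set R : ℝ := (k : ℝ) ^ 2 with hRdef
    have hR : 0 < R := by positivity
    have hmR : (m : ℝ) + 1 ≤ R := by
      have h1 : (m : ℝ) + 1 ≤ k := by exact_mod_cast hk
      have h2 : (k : ℝ) ≤ (k : ℝ) ^ 2 := by nlinarith
      exact h1.trans h2
    calc ENNReal.ofReal ν * ∫⁻ q in Ioo (0 : ℝ) T' ×ˢ ball (0 : (EuclideanSpace ℝ (Fin 3))) ((m : ℝ) + 1),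
          ENNReal.ofReal (((∑ i, (‖fderiv ℝ (vorticity u q.1) q.2 ((stdOrthonormalBasis ℝ (EuclideanSpace ℝ (Fin 3))) i)‖ ^ 2 * ‖(vorticity u q.1) q.2‖ ^ 2 - ⟪(vorticity u q.1) q.2, fderiv ℝ (vorticity u q.1) q.2 ((stdOrthonormalBasis ℝ (EuclideanSpace ℝ (Fin 3))) i)⟫ ^ 2)) / Real.sqrt (‖(vorticity u q.1) q.2‖ ^ 2 + ε ^ 2) ^ 3))
        ≤ ENNReal.ofReal ν * ∫⁻ q in Ioo (0 : ℝ) T' ×ˢ (univ : Set (EuclideanSpace ℝ (Fin 3))),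
            ENNReal.ofReal (cutoff R q.2 * ((∑ i, (‖fderiv ℝ (vorticity u q.1) q.2 ((stdOrthonormalBasis ℝ (EuclideanSpace ℝ (Fin 3))) i)‖ ^ 2 * ‖(vorticity u q.1) q.2‖ ^ 2 - ⟪(vorticity u q.1) q.2, fderiv ℝ (vorticity u q.1) q.2 ((stdOrthonormalBasis ℝ (EuclideanSpace ℝ (Fin 3))) i)⟫ ^ 2)) / Real.sqrt (‖(vorticity u q.1) q.2‖ ^ 2 + ε ^ 2) ^ 3)) := by
          gcongr ENNReal.ofReal ν * ?_
          calc ∫⁻ q in Ioo (0 : ℝ) T' ×ˢ ball (0 : (EuclideanSpace ℝ (Fin 3))) ((m : ℝ) + 1),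
                ENNReal.ofReal (((∑ i, (‖fderiv ℝ (vorticity u q.1) q.2 ((stdOrthonormalBasis ℝ (EuclideanSpace ℝ (Fin 3))) i)‖ ^ 2 * ‖(vorticity u q.1) q.2‖ ^ 2 - ⟪(vorticity u q.1) q.2, fderiv ℝ (vorticity u q.1) q.2 ((stdOrthonormalBasis ℝ (EuclideanSpace ℝ (Fin 3))) i)⟫ ^ 2)) / Real.sqrt (‖(vorticity u q.1) q.2‖ ^ 2 + ε ^ 2) ^ 3))
              = ∫⁻ q in Ioo (0 : ℝ) T' ×ˢ ball (0 : (EuclideanSpace ℝ (Fin 3))) ((m : ℝ) + 1),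
                  ENNReal.ofReal (cutoff R q.2 * ((∑ i, (‖fderiv ℝ (vorticity u q.1) q.2 ((stdOrthonormalBasis ℝ (EuclideanSpace ℝ (Fin 3))) i)‖ ^ 2 * ‖(vorticity u q.1) q.2‖ ^ 2 - ⟪(vorticity u q.1) q.2, fderiv ℝ (vorticity u q.1) q.2 ((stdOrthonormalBasis ℝ (EuclideanSpace ℝ (Fin 3))) i)⟫ ^ 2)) / Real.sqrt (‖(vorticity u q.1) q.2‖ ^ 2 + ε ^ 2) ^ 3)) := by
                  refine setLIntegral_congr_fun (measurableSet_Ioo.prod measurableSet_ball)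
                    fun q hq => ?_
                  rw [cutoff_eq_one hR ((mem_ball_zero_iff.1 hq.2).le.trans hmR), one_mul]
            _ ≤ _ := lintegral_mono_set (prod_mono Subset.rfl (subset_univ _))
      _ = ENNReal.ofReal (ν * ∫ τ in Ioo 0 T', ∫ x, cutoff R x * ((∑ i, (‖fderiv ℝ (vorticity u τ) x ((stdOrthonormalBasis ℝ (EuclideanSpace ℝ (Fin 3))) i)‖ ^ 2 * ‖(vorticity u τ) x‖ ^ 2 - ⟪(vorticity u τ) x, fderiv ℝ (vorticity u τ) x ((stdOrthonormalBasis ℝ (EuclideanSpace ℝ (Fin 3))) i)⟫ ^ 2)) / Real.sqrt (‖(vorticity u τ) x‖ ^ 2 + ε ^ 2) ^ 3)) := by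
          rw [hns'.lintegral_prod_cutoff_dirDissLow_eq hT'0 hε.ne' hR, ← ENNReal.ofReal_mul hν.le]
      _ ≤ ENNReal.ofReal (Kω + D.toReal + err k) :=
          ENNReal.ofReal_le_ofReal (hreal hε hT'0 hT'T k hk1)
  -- exhaustion: the bound on all of `(0, T) × ℝ³`, for `ε > 0`
  have hE : ∀ {ε : ℝ}, 0 < ε →
      ENNReal.ofReal ν * ∫⁻ q in Ioo (0 : ℝ) T ×ˢ (univ : Set (EuclideanSpace ℝ (Fin 3))),
        ENNReal.ofReal (((∑ i, (‖fderiv ℝ (vorticity u q.1) q.2 ((stdOrthonormalBasis ℝ (EuclideanSpace ℝ (Fin 3))) i)‖ ^ 2 * ‖(vorticity u q.1) q.2‖ ^ 2 - ⟪(vorticity u q.1) q.2, fderiv ℝ (vorticity u q.1) q.2 ((stdOrthonormalBasis ℝ (EuclideanSpace ℝ (Fin 3))) i)⟫ ^ 2)) / Real.sqrt (‖(vorticity u q.1) q.2‖ ^ 2 + ε ^ 2) ^ 3)) ≤ ENNReal.ofReal (Kω + D.toReal) := by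
    intro ε hε
    have hdir : Directed (· ⊆ ·) fun m : ℕ =>
        Ioo (0 : ℝ) (T - T / ((m : ℝ) + 2)) ×ˢ ball (0 : (EuclideanSpace ℝ (Fin 3))) ((m : ℝ) + 1) := by
      refine Monotone.directed_le fun a b hab => prod_mono (Ioo_subset_Ioo le_rfl ?_)
        (ball_subset_ball (by exact_mod_cast Nat.succ_le_succ hab))
      gcongr
    rw [← iUnion_Ioo_prod_ball hT, setLIntegral_iUnion_of_directed _ hdir, ENNReal.mul_iSup]
    exact iSup_le fun m => hQ hε m
  -- monotone convergence `ε = 1/(n+1) → 0`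
  have hwT : IsSmoothSpaceTimeOn (Ico 0 T) (vorticity u) :=
    hns.isSmoothSpaceTimeOn_vorticity (uniqueDiffOn_Ico 0 T)
  have hmeas : ∀ n : ℕ, AEMeasurable (fun q : ℝ × (EuclideanSpace ℝ (Fin 3)) =>
      ENNReal.ofReal (((∑ i, (‖fderiv ℝ (vorticity u q.1) q.2 ((stdOrthonormalBasis ℝ (EuclideanSpace ℝ (Fin 3))) i)‖ ^ 2 * ‖(vorticity u q.1) q.2‖ ^ 2 - ⟪(vorticity u q.1) q.2, fderiv ℝ (vorticity u q.1) q.2 ((stdOrthonormalBasis ℝ (EuclideanSpace ℝ (Fin 3))) i)⟫ ^ 2)) / Real.sqrt (‖(vorticity u q.1) q.2‖ ^ 2 + (((n : ℝ) + 1)⁻¹) ^ 2) ^ 3)))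
      ((volume : Measure (ℝ × (EuclideanSpace ℝ (Fin 3)))).restrict (Ioo (0 : ℝ) T ×ˢ (univ : Set (EuclideanSpace ℝ (Fin 3))))) := fun n =>
    (((continuousOn_dirDissLow_slab hwT (uniqueDiffOn_Ico 0 T) (by positivity)).mono
      (prod_mono Ioo_subset_Ico_self Subset.rfl)).aemeasurable
      (measurableSet_Ioo.prod MeasurableSet.univ)).ennreal_ofReal
  have hsup : ∫⁻ q in Ioo (0 : ℝ) T ×ˢ (univ : Set (EuclideanSpace ℝ (Fin 3))),
      ENNReal.ofReal (‖curl (u q.1) q.2‖ *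
        frobeniusNormSq (fderiv ℝ (vorticityDirection (curl (u q.1))) q.2)) =
      ⨆ n : ℕ, ∫⁻ q in Ioo (0 : ℝ) T ×ˢ (univ : Set (EuclideanSpace ℝ (Fin 3))),
        ENNReal.ofReal (((∑ i, (‖fderiv ℝ (vorticity u q.1) q.2 ((stdOrthonormalBasis ℝ (EuclideanSpace ℝ (Fin 3))) i)‖ ^ 2 * ‖(vorticity u q.1) q.2‖ ^ 2 - ⟪(vorticity u q.1) q.2, fderiv ℝ (vorticity u q.1) q.2 ((stdOrthonormalBasis ℝ (EuclideanSpace ℝ (Fin 3))) i)⟫ ^ 2)) / Real.sqrt (‖(vorticity u q.1) q.2‖ ^ 2 + (((n : ℝ) + 1)⁻¹) ^ 2) ^ 3)) := by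
    rw [← lintegral_iSup' hmeas (ae_of_all _ fun q a b hab =>
      ENNReal.ofReal_le_ofReal (monotone_dirDissLow_seq _ _ hab))]
    refine setLIntegral_congr_fun (measurableSet_Ioo.prod MeasurableSet.univ) fun q hq => ?_
    have h2 : ContDiff ℝ 2 (u q.1) := contDiff_infty.1 (hns.contDiff_velocity (Ioo_subset_Ico_self hq.1)) 2
    have hc1 : ContDiff ℝ 1 (curl (u q.1)) := contDiff_curl (n := 1) (by exact_mod_cast h2)
    have hdiff : DifferentiableAt ℝ (curl (u q.1)) q.2 := (hc1.differentiable one_ne_zero) q.2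
    rw [norm_mul_frobeniusNormSq_fderiv_vorticityDirection hdiff, ← iSup_ofReal_dirDissLow_seq]
    rfl
  -- conclusion
  have hmain : ENNReal.ofReal ν * ∫⁻ q in Ioo (0 : ℝ) T ×ˢ (univ : Set (EuclideanSpace ℝ (Fin 3))),
      ENNReal.ofReal (‖curl (u q.1) q.2‖ *
        frobeniusNormSq (fderiv ℝ (vorticityDirection (curl (u q.1))) q.2)) ≤
      ENNReal.ofReal (Kω + D.toReal) := by
    rw [hsup, ENNReal.mul_iSup]
    exact iSup_le fun n => hE (by positivity)
  refine hmain.trans ?_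
  -- `ofReal (‖ω₀‖₁ + ∫∫|∇u|²) ≤ ∫⁻ ‖ω₀‖ₑ + (2ν)⁻¹ ∫⁻ ‖u₀‖ₑ²`
  have hK : ENNReal.ofReal Kω = ∫⁻ x, ‖curl (u 0) x‖ₑ := by
    rw [hKω, ofReal_integral_eq_lintegral_ofReal hω₀ (Eventually.of_forall fun x => norm_nonneg _)]
    exact lintegral_congr fun x => ofReal_norm _
  have hu₀ : Integrable fun x => ‖u 0 x‖ ^ 2 :=
    (hlh.memLp 0 ⟨le_rfl, hT.le⟩).integrable_norm_pow two_ne_zero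
  have hDle : ENNReal.ofReal D.toReal ≤ (ENNReal.ofReal (2 * ν))⁻¹ * ∫⁻ x, ‖u 0 x‖ₑ ^ 2 := by
    have h1 : D.toReal ≤ (2 * ν)⁻¹ * ∫ x, ‖u 0 x‖ ^ 2 := by
      rw [VectorCalculus.kineticEnergy] at hDE
      calc D.toReal = ν⁻¹ * (ν * D.toReal) := by field_simp
        _ ≤ ν⁻¹ * (2⁻¹ * ∫ x, ‖u 0 x‖ ^ 2) := by gcongr
        _ = (2 * ν)⁻¹ * ∫ x, ‖u 0 x‖ ^ 2 := by ring
    calc ENNReal.ofReal D.toReal ≤ ENNReal.ofReal ((2 * ν)⁻¹ * ∫ x, ‖u 0 x‖ ^ 2) :=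
          ENNReal.ofReal_le_ofReal h1
      _ = (ENNReal.ofReal (2 * ν))⁻¹ * ∫⁻ x, ‖u 0 x‖ₑ ^ 2 := by
          rw [ENNReal.ofReal_mul (by positivity), ENNReal.ofReal_inv_of_pos (by positivity),
            ofReal_integral_sq_norm hu₀]
  rw [ENNReal.ofReal_add hKω0 hDr0, hK]
  gcongr

end Final

end Literature.Analysis.FluidPDE
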